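import Literature.MathematicalPhysics.QuantumFieldTheory.Balaban1983to89.B9Ineq346L2Final
import Literature.MathematicalPhysics.QuantumFieldTheory.Balaban1983to89.B9Thm34HolderInputG

/-!
# `Balaban1983to89.B9Ineq346L2SecondDiff` — [Balaban1985BackgroundPropagators] THEOREM 3.4 p. 400 × THEOREM 3.1 (3.46)₄ p. 398 / THEOREM 3.3 p. 399:
# THE `L²` MEMBER WITH TWO LEFT DIFFERENCES («‖h∇_U∇_UG′(U)λ‖ ≦ B₀·1·|h|e^{−δ₀d(y,y′)}‖λ‖») FOR BOTH EXTENDED OPERATORS `G′(U′U)` (3.64) AND `G(U′U)`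
# (FILE 28), AT THE FINAL LEVEL — from (3.46)₄ FOR `U` (an `L²` block input), the KERNEL bounds of `V′(A)G′(U′U)` / `V(A)G(U′U)` ((3.63)/(3.85) for the
# extended operators, assembled from FILES 16/28's kernel entries and the concrete letters), (3.65)₁, Minkowski and FILE 39's Schur step;
# FILE 40 of the Sect. B programme of cell `lit-balaban`, seat r06 gen 18; narrows GAPS G-B9-02 to the single member (3.46)₆

statement-level skeleton of published theorems with citation tags; proofs where landed; nothing here is a claim about the Yang–Mills mass gap

CITATION HEADER (lean-in-tree rule).  B9 = T. Bałaban, *Propagators for lattice gauge theories in a background field*, Commun. Math. Phys. **99** (1985)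
389–434 [Balaban1985BackgroundPropagators] (doi 10.1007/bf01240355; `paper:balaban1985-cmp99-background-propagators`, journal page = PDF page + 388):
Theorem 3.1 (3.46) p. 398 [PDF 10] verbatim (page image `inprint/lit-balaban-p05/renders/cmp99b/p10.png`): «Finally, we have the inequalities in L²-norms ‖hG′(U)λ‖, ‖h∇_UG′(U)λ‖, ‖hG′(U)∇*_Uλ‖, ‖h∇_U∇_UG′(U)λ‖, ‖h∇_UG′(U)∇*_Uλ‖, ‖hG′(U)∇*_U∇*_Uλ‖ ≦ B₀[(Lʲη)², Lʲη, Lʲη, 1, 1, 1]|h|e^{−δ₀d(y,y′)}‖λ‖ for supp h ⊂ Δ(y), y ∈ Λ_j, supp λ ⊂ Δ(y′); (3.46)» — this file: the FOURTH member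
(weight `1`); Theorem 3.3 p. 399 [PDF 11] («with G′(U) replaced by G(U) and λ replaced by a function J defined at bonds of the lattice»); Theorem 3.4
p. 400 [PDF 12] («The extended operators satisfy all the inequalities of Theorems 3.1–3.3 correspondingly»); (3.63)–(3.65) p. 402 [PDF 14] («the operator
V′(A)G′(U) satisfies the bound |(V′(A)G′(U)λ)(x)| ≦ O(1)B₀α₁e^{−δ₀d(y,y′)}|λ| (3.63)»; «G′(U′U) = G′(U) + G′(U)V′(A)G′(U′U) = G′(U) + G′(U′U)V′(A)G′(U), (3.65)» —
THIS FILE USES THE FIRST EQUALITY); p. 403 l. 2–9 («… They satisfy Theorem 3.1 with the additional small factor O(1)α₁» for the remainders of (3.65));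
(3.84)–(3.86) p. 407 [PDF 19] (page image `p19.png`: «|(V(A)G(U)J)(b)| ≦ O(1)α₁e^{−(1/2)δ₀d(y,y′)}|J| for b ∈ Δ(y), supp J ⊂ Δ(y′). (3.85)», «This way we get
all these inequalities for the operator G(U′U), the local ones follow from the bound (3.85) and Lemma 2.1 [4]»); p. 393 (kernel pairing), p. 398 remark («the choice of powers Lʲη is conventional also …»).  [4] = T. Bałaban, *Propagators and renormalization
transformations for lattice gauge theories. II*, Commun. Math. Phys. **96** (1984) 223–250 [Balaban1984PropagatorsII], (2.52) p. 232, (2.64)–(2.66)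
p. 234, Lemma 2.1 (2.61) p. 234.  Cell `lit-balaban`, seat r06 (B9 fold owner) gen 18, FILE 40; SKELETON rows **B9.Thm3.4** × B9.Thm3.1 ((3.46) cell) ×
B9.Thm3.3 × B9.Eq3.62 ((3.65)) × B9.Eq3.85 (cells); no row head changes.

WHY THIS FILE (B9-CLOSURE §5 item 3 (O′)).  FILE 39 obtained the four members of (3.46) with at most one difference on each side from the KERNEL form of
(3.42) by Schur's test.  The member with two differences on the LEFT, `‖h∇_U∇_UG′λ‖`, is NOT a consequence of (3.42) (no sup/kernel bound for second
differences is printed); it transfers from `U` to `U′U` by the first equality of (3.65): `∇∇G′(U′U) = ∇∇G′(U) + ∇∇G′(U)·[V′(A)G′(U′U)]`, where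
`∇∇G′(U)` carries the `L²` block bound (3.46)₄ FOR `U` (an INPUT, per pair of differences) and `W = V′(A)G′(U′U)` carries a KERNEL bound — (3.63) for
the extended operator, which the tree assembles from FILE 16's kernel entries of `G′(U′U)`, `∇_kG′(U′U)` and the concrete `V′(A)` letters
(`B9Thm34GpKernelFinal.ineq363_kernel_vPrime`); inserting `Σ_{y″}Δ(y″) = I` between the two factors ([4] (2.52)), Minkowski, (3.46)₄ for `U` per piece,
FILE 39's Schur bound for `‖Δ(y″)Wλ‖₂` (`l2_block_of_kernelBound_transfer` with the indicator of `Δ(y″)` as multiplier) and [4] (2.61) for the `y″`-sum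
give `‖h∇∇G′(U′U)λ‖₂ ≦ B|h|e^{−ρd(y,y′)}‖λ‖₂`.  The `G(U′U)` side is the same with `W = V(A)G(U′U)`, `V(A) = V₃ + P₁ + P₂` ((3.84)), whose kernel
bound is `B9Ineq385KernelConcrete.ineq385_kernel_sum` fed with FILE 28's kernel entries of `G(U′U)`, the gradient form and (3.73) sizes of the
concrete `V₃(A)` (gen 11), (3.77) for `P₁(A)` (FILE 25 §3, its `C⁻¹(U′U)` identified with FILE 28's) and (3.83) for `P₂(A)`.
* §1 (private plumbing) `sqrt_sum_sq_eq_norm`, `sqrt_sum_sq_add_le`, `sqrt_sum_sq_sum_le` — the counting `ℓ²` norm of the real coordinates is a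
  Euclidean norm (Minkowski, Mathlib `EuclideanSpace.norm_eq` + `norm_add_le`).
* §2 **`l2_left_transfer`** (abstract device on a block carrier), `resolvent_left` ((3.65)₁ from `GΔ = 1`, `(Δ − V)G_ext = 1`).
* §3 **`thm34_Gp_l2_second_final`** — HYPOTHESES = FILE 16 `thm34_Gp_kernel_final` VERBATIM + `hvol`, `hSTv` (as FILE 39) + NEW (3.46)₄ FOR `G′(U)` as an
  `L²` block input for every pair `∇_k∇_m` (`h346`); CONCLUSION `∃ a₁ > 0 ∃ B ≧ 0 ∀ α₁ ≦ a₁ ∀ A kF sF …` (FILE 16's premises): the inverse identities ∧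
  `∀ k m y y′ h λ`, `‖h∇_k∇_mG′(U′U)λ‖₂ ≦ B|h|e^{−(13δ₀/20)d(y,y′)}‖λ‖₂`.
* §4 **`thm34_G_l2_second_final`** — HYPOTHESES = FILE 28 `thm34_all_final` VERBATIM + `hvol`, `hSTv` + (3.46)₄ FOR `G(U)`; CONCLUSION `∃ a₁ ∃ B ∀ α₁ …`
  (FILE 28's premises) `∃ C⁻¹(U′U), G(U′U)` (FILE 28's pair, identities re-exported) ∧ `∀ k m y y′ h J`, `‖h∇_k∇_mG(U′U)J‖₂ ≦ B|h|e^{−(7δ₀/100)d}‖J‖₂`.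

HONEST SCOPE.  (a) Covered: (3.46)₄ (two differences on the LEFT) for both extended operators; NOT covered: (3.46)₆ `‖hG′∇*_U∇*_Uλ‖` (two differences
on the RIGHT) — by (3.65)₂ it needs `L²` bounds for the LOCAL letters of `V′(A)` / `V(A)` acting on an `L²`-controlled input (an `L²` letter
calculus) or a transposition argument; neither is in the tree (B9-CLOSURE (O″), open).  (b) (3.46)₄ FOR `U` enters as an INPUT in `L²` block form per
pair of concrete first differences (`h346`, constant `B₄₆`, rate `δ₀`), exactly the printed member read in the counting norms of the real coordinates;
it is NOT derived here (it is [4]'s `L²` regularity, Theorem 3.1's own content).  (c) Norms, `|h|`, `hvol`, `hSTv` as in FILE 39 (c), (d).  (d) Rates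
`13δ₀/20` (`G′`) and `7δ₀/100` (`G`); «different constants».  (e) No new definition, no named fact, no row head change (B9.Thm3.4 stays `typed-existing`).

Depends on: `B9Ineq346L2Final` (FILE 39: `l2_block_of_kernelBound_transfer`), `B9Thm34GpKernelFinal` (FILE 16: `thm34_Gp_kernel_final`,
`ineq363_kernel_vPrime`), `B9Thm34AllFinal` (FILE 28), `B9Thm34GKernelFinal` (`exists_threshold_pOne`, `exists_bound_of_continuousAt`),
`B9Ineq385KernelConcrete` (`ineq385_kernel_sum`), `B9Ineq385VG` (`ineq383_op`, `kappa383`, `kappa385`), `B9Ineq385V3Concrete` (`cV385`),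
`B9Eq382V3Letters` (`conj_V₃Op_eq_gradForm`, `conj_V₃Op_eq_vThree`, `hasMajorant_V₃_zero`, `hasMajorant_V₃_one`), `B9Eq372RemLetters`
(`conj_lapDDLetter_prodCfg`), `B9Eq376POneLetters` (`eq376_concrete`), `B9Eq386Neumann` (`eq384_sub`, `vTotal`), `B9Ineq363Vprime` (`theta363`),
`B9Ineq366CPrime` (`conv_le`, `scaleTransfer_one`, `hasMajorant_rate_mono`), `B6RandomWalk` (`blockPiece`, `sum_blockPiece`), Mathlib
`EuclideanSpace.norm_eq`, `norm_add_le`, `left_inv_eq_right_inv` — all used BY NAME.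
-/

noncomputable section

namespace Literature.MathematicalPhysics.QuantumFieldTheory.Balaban1983to89.B9Ineq346L2SecondDiff

open NormedSpace Complex
open Literature.MathematicalPhysics.QuantumFieldTheory.Balaban1983to89
open Literature.MathematicalPhysics.QuantumFieldTheory.Balaban1983to89.B6RandomWalk (HasMajorant BlockSupp blockPiece sum_blockPiece hasMajorant_mono Triangle254 Ineq261)
open Literature.MathematicalPhysics.QuantumFieldTheory.Balaban1983to89.B6RandomWalkHom (HasMajorantHom)
open Literature.MathematicalPhysics.QuantumFieldTheory.Balaban1983to89.B6RandomWalkKernel (ker apply_eq_sum_ker HasKernelBound hasKernelBound_mono)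
open Literature.MathematicalPhysics.QuantumFieldTheory.Balaban1983to89.B6RandomWalkSection (secExt secRes secConj)
open Literature.MathematicalPhysics.QuantumFieldTheory.Balaban1983to89.B9Thm34Ext (toB6)
open Literature.MathematicalPhysics.QuantumFieldTheory.Balaban1983to89.B9Ineq347 (ScaleTransfer)
open Literature.MathematicalPhysics.QuantumFieldTheory.Balaban1983to89.B9Eq386Neumann (vTotal vThree pTwo deltaA eq384_sub)
open Literature.MathematicalPhysics.QuantumFieldTheory.Balaban1983to89.B9Eq39Adjoint
open Literature.MathematicalPhysics.QuantumFieldTheory.Balaban1983to89.B9Eq369Small (Through)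
open Literature.MathematicalPhysics.QuantumFieldTheory.Balaban1983to89.B9Eq372Locality (stBonds)
open Literature.MathematicalPhysics.QuantumFieldTheory.Balaban1983to89.B9Eq352DivForm (tauF tauB)
open Literature.MathematicalPhysics.QuantumFieldTheory.Balaban1983to89.B9Eq352DivFormLetters
open Literature.MathematicalPhysics.QuantumFieldTheory.Balaban1983to89.B9Eq352GradLetters (diffLetter)
open Literature.MathematicalPhysics.QuantumFieldTheory.Balaban1983to89.B9Eq371GradLetters (bT bU zeroLetter V1Letter)
open Literature.MathematicalPhysics.QuantumFieldTheory.Balaban1983to89.B9Eq375GradLetters (zeroLetter₂ V1Letter₂)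
open Literature.MathematicalPhysics.QuantumFieldTheory.Balaban1983to89.B9Eq372RemLetters
open Literature.MathematicalPhysics.QuantumFieldTheory.Balaban1983to89.B9Eq382V3Letters
open Literature.MathematicalPhysics.QuantumFieldTheory.Balaban1983to89.B9Eq376POneLetters (conjHom gradLin divLin eq376_concrete)
open Literature.MathematicalPhysics.QuantumFieldTheory.Balaban1983to89.B9Eq360Vprime (gPrimeExtEnd)
open Literature.MathematicalPhysics.QuantumFieldTheory.Balaban1983to89.B9Eq360VprimeLetters (vPrimeConc)
open Literature.MathematicalPhysics.QuantumFieldTheory.Balaban1983to89.B9Ineq385VG (kappa383 kappa383_nonneg ineq383_op kappa385 kappa385_nonneg)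
open Literature.MathematicalPhysics.QuantumFieldTheory.Balaban1983to89.B9Ineq385V3Concrete (cV385 cV0_nonneg cV385_nonneg)
open Literature.MathematicalPhysics.QuantumFieldTheory.Balaban1983to89.B9Ineq385Kernel (exp_rate_mono)
open Literature.MathematicalPhysics.QuantumFieldTheory.Balaban1983to89.B9Ineq385KernelConcrete (ineq385_kernel_sum)
open Literature.MathematicalPhysics.QuantumFieldTheory.Balaban1983to89.B9Ineq363Vprime (cVConc theta363 theta363_nonneg)
open Literature.MathematicalPhysics.QuantumFieldTheory.Balaban1983to89.B9Eq360VprimeLetters (cBConc)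
open Literature.MathematicalPhysics.QuantumFieldTheory.Balaban1983to89.B9Ineq366CPrime (conv_le scaleTransfer_one hasMajorant_rate_mono)
open Literature.MathematicalPhysics.QuantumFieldTheory.Balaban1983to89.B9Thm34GKernelFinal (exists_threshold_pOne exists_bound_of_continuousAt)
open Literature.MathematicalPhysics.QuantumFieldTheory.Balaban1983to89.B9Thm34GpKernelFinal (ineq363_kernel_vPrime thm34_Gp_kernel_final)
open Literature.MathematicalPhysics.QuantumFieldTheory.Balaban1983to89.B9Thm34AllFinal (thm34_all_final)
open Literature.MathematicalPhysics.QuantumFieldTheory.Balaban1983to89.B9Ineq346L2Final (l2_block_of_kernelBound_transfer)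

/-! ## §1  `ℓ²` bookkeeping: the counting norm of the real coordinates is a Euclidean norm (Minkowski) -/

section L2

variable {X : Type} [Fintype X]

/-- `(Σ_x f(x)²)^{1/2}` is the Euclidean norm of `f` (plumbing). [folklore] -/
private theorem sqrt_sum_sq_eq_norm (f : X → ℝ) : Real.sqrt (∑ x, f x ^ 2) = ‖(WithLp.toLp 2 f : EuclideanSpace ℝ X)‖ := by
  rw [EuclideanSpace.norm_eq]
  congr 1
  refine Finset.sum_congr rfl fun x _ => ?_
  rw [PiLp.toLp_apply, Real.norm_eq_abs, sq_abs]

/-- Minkowski for two summands (plumbing). [folklore] -/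
private theorem sqrt_sum_sq_add_le (f₁ f₂ : X → ℝ) :
    Real.sqrt (∑ x, (f₁ x + f₂ x) ^ 2) ≤ Real.sqrt (∑ x, f₁ x ^ 2) + Real.sqrt (∑ x, f₂ x ^ 2) := by
  have e : (∑ x, (f₁ x + f₂ x) ^ 2) = ∑ x, ((f₁ + f₂) x) ^ 2 := rfl
  rw [e, sqrt_sum_sq_eq_norm, sqrt_sum_sq_eq_norm, sqrt_sum_sq_eq_norm, WithLp.toLp_add]
  exact norm_add_le _ _

/-- Minkowski for a finite sum (plumbing). [folklore] -/
private theorem sqrt_sum_sq_sum_le {I : Type*} (s : Finset I) (F : I → X → ℝ) :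
    Real.sqrt (∑ x, (∑ i ∈ s, F i x) ^ 2) ≤ ∑ i ∈ s, Real.sqrt (∑ x, F i x ^ 2) := by
  classical
  refine Finset.induction_on s ?_ ?_
  · simp
  · intro a s ha ih
    simp only [Finset.sum_insert ha]
    exact (sqrt_sum_sq_add_le _ _).trans (by linarith)

end L2

/-! ## §2  The abstract transfer: an `L²` block bound for `T₀ = D₂G(U)` and a KERNEL bound for `W = V·G(U′U)` give the `L²` block bound for
`D₂G(U′U) = T₀ + T₀W` -/

section Device

variable {g : B9.Geometry} [Fintype g.Site] [DecidableEq g.Site] {R : ℝ} {H : Prop} {X : Type} [Fintype X] [DecidableEq X]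

set_option maxHeartbeats 800000 in
/-- **`L²` MEMBER WITH TWO LEFT DIFFERENCES SURVIVES THE PERTURBATION — abstract device.**  On a block carrier: `T₀` (in use: `∇_k∇_mG′(U)`) with the
`L²` block bound `‖h·T₀ν‖₂ ≦ A₀|h|e^{−rd(y,y″)}‖ν‖₂` ((3.46)₄ FOR `U`), `W` (in use: `V′(A)G′(U′U)`) with the KERNEL bound `|W(x,x′)| ≦ A_We^{−ρd}v(y′)⁻¹`
((3.63) for the extended operator), and `E = T₀ + T₀W` (in use: `∇_k∇_mG′(U′U)`, from `G′(U′U) = G′(U) + G′(U)V′(A)G′(U′U)`, (3.65)₁).  THEN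
`‖h·Eλ‖₂ ≦ A₀(1 + c_vΛA_Wc₁(δ₀,β))|h|e^{−ρ′d(y,y′)}‖λ‖₂` for `ρ′ + αδ₀ ≦ ρ`, `ρ′ + (α′+β)δ₀ ≦ r`: insert `Σ_{y″}Δ(y″) = I` between `T₀` and `W`
([4] (2.52)), Minkowski, the input bound per piece, Schur for the piece (FILE 39 `l2_block_of_kernelBound_transfer` with the indicator of `Δ(y″)` as
multiplier), and [4] (2.61) for the `y″`-sum (`conv_le`).
[cite: Balaban1985BackgroundPropagators, Thm 3.4 p.400 + (3.46) p.398 + (3.63)–(3.65) p.402 + p.403 l.2–5; Balaban1984PropagatorsII, (2.52) p.232 + Lemma 2.1 (2.61) p.234 (bookkeeping ours)] -/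
theorem l2_left_transfer (blk : X → g.Site) {v : g.Site → ℝ} (hv : ∀ y, 0 < v y) {c cv : ℝ} (hc : 0 < c)
    (hvol : ∀ y : g.Site, c * ((Finset.univ.filter (fun x : X => blk x = y)).card : ℝ) ≤ cv * v y) (d : ℕ)
    {δ₀ α α' β Λ ρ ρ' r A₀ AW : ℝ} (hA₀ : 0 ≤ A₀) (hAW : 0 ≤ AW) (hδ₀ : 0 ≤ δ₀) (hα' : 0 ≤ α') (hβ : 0 ≤ β) (hρ' : 0 ≤ ρ')
    (hρ'ρ : ρ' + α * δ₀ ≤ ρ) (hr : ρ' + (α' + β) * δ₀ ≤ r)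
    (hdnn : ∀ a a' : g.Site, 0 ≤ g.dist a a') (htri : Triangle254 (toB6 g R H)) (h261 : Ineq261 d (toB6 g R H) δ₀ β)
    (hT : ScaleTransfer g δ₀ α Λ (fun a => (Real.sqrt (v a))⁻¹))
    {T₀ W E : Module.End ℝ (X → ℝ)} (hE : E = T₀ + T₀ * W)
    (hT₀ : ∀ (y y'' : g.Site) (hf ν : X → ℝ) (Hh : ℝ), 0 ≤ Hh → (∀ x, |hf x| ≤ Hh) → (∀ x, blk x ≠ y → hf x = 0) →
      (∀ x, blk x ≠ y'' → ν x = 0) →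
      Real.sqrt (∑ x, (hf x * T₀ ν x) ^ 2) ≤ A₀ * Hh * Real.exp (-(r * g.dist y y'')) * Real.sqrt (∑ x, ν x ^ 2))
    (hW : HasKernelBound (g := toB6 g R H) blk v c W (fun a a' => AW * Real.exp (-(ρ * g.dist a a'))))
    (y y' : g.Site) (hf μ : X → ℝ) (Hh : ℝ) (hHh : 0 ≤ Hh) (hh : ∀ x, |hf x| ≤ Hh) (hh0 : ∀ x, blk x ≠ y → hf x = 0)
    (hμ0 : ∀ x, blk x ≠ y' → μ x = 0) :
    Real.sqrt (∑ x, (hf x * E μ x) ^ 2) ≤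
      (A₀ * (1 + cv * Λ * AW * B6.c1 d δ₀ β)) * Hh * Real.exp (-(ρ' * g.dist y y')) * Real.sqrt (∑ x, μ x ^ 2) := by
  classical
  obtain ⟨y₀⟩ : Nonempty g.Site := ⟨y⟩
  have hN : 0 ≤ Real.sqrt (∑ x, μ x ^ 2) := Real.sqrt_nonneg _
  have hc₁ : 0 ≤ B6.c1 d δ₀ β := B6RandomWalk.c1_nonneg d δ₀ β
  have hρ'r : ρ' ≤ r := by nlinarith [mul_nonneg (add_nonneg hα' hβ) hδ₀]
  have hcv : 0 ≤ cv := by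
    have h4 : 0 ≤ c * ((Finset.univ.filter (fun x : X => blk x = y₀)).card : ℝ) := by positivity
    have h0 : 0 * v y₀ ≤ cv * v y₀ := by rw [zero_mul]; exact h4.trans (hvol y₀)
    exact le_of_mul_le_mul_right h0 (hv y₀)
  have hΛ : 0 ≤ Λ := by
    have hs : 0 < (Real.sqrt (v y₀))⁻¹ := inv_pos.mpr (Real.sqrt_pos.mpr (hv y₀))
    have h0 : 0 * (Real.sqrt (v y₀))⁻¹ ≤ Λ * (Real.sqrt (v y₀))⁻¹ := by
      rw [zero_mul]
      exact (mul_nonneg (Real.exp_nonneg _) hs.le).trans (hT y₀ y₀)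
    exact le_of_mul_le_mul_right h0 hs
  -- `Eλ = T₀λ + Σ_{y″} T₀(Δ(y″)·Wλ)` ([4] (2.52))
  have hsplit : ∀ x, hf x * E μ x =
      hf x * T₀ μ x + ∑ y'' : g.Site, hf x * T₀ (blockPiece (g := toB6 g R H) blk y'' (W μ)) x := by
    intro x
    have e2 : T₀ (W μ) = ∑ y'' : g.Site, T₀ (blockPiece (g := toB6 g R H) blk y'' (W μ)) := by
      rw [← map_sum]
      exact congrArg T₀ (sum_blockPiece (g := toB6 g R H) blk (W μ)).symm
    rw [hE, LinearMap.add_apply, Module.End.mul_apply, Pi.add_apply, e2, Finset.sum_apply, mul_add, Finset.mul_sum]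
  -- Minkowski
  have hmain : Real.sqrt (∑ x, (hf x * E μ x) ^ 2) ≤ Real.sqrt (∑ x, (hf x * T₀ μ x) ^ 2) +
      ∑ y'' : g.Site, Real.sqrt (∑ x, (hf x * T₀ (blockPiece (g := toB6 g R H) blk y'' (W μ)) x) ^ 2) := by
    have e : (∑ x, (hf x * E μ x) ^ 2) =
        ∑ x, (hf x * T₀ μ x + ∑ y'' : g.Site, hf x * T₀ (blockPiece (g := toB6 g R H) blk y'' (W μ)) x) ^ 2 :=
      Finset.sum_congr rfl fun x _ => by rw [hsplit x]
    rw [e]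
    exact (sqrt_sum_sq_add_le _ _).trans (add_le_add le_rfl (sqrt_sum_sq_sum_le _ _))
  -- the unperturbed term
  have h1 : Real.sqrt (∑ x, (hf x * T₀ μ x) ^ 2) ≤ A₀ * Hh * Real.exp (-(ρ' * g.dist y y')) * Real.sqrt (∑ x, μ x ^ 2) :=
    (hT₀ y y' hf μ Hh hHh hh hh0 hμ0).trans
      (mul_le_mul_of_nonneg_right (mul_le_mul_of_nonneg_left (exp_rate_mono hρ'r (hdnn _ _)) (mul_nonneg hA₀ hHh)) hN)
  -- each piece: the input bound for `T₀`, then Schur for `Δ(y″)·Wλ`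
  have hW' := hasKernelBound_mono (g := toB6 g R H) blk hv hW (K' := fun a a' => AW * (1 : ℝ) * Real.exp (-(ρ * g.dist a a')))
    fun a a' => le_of_eq (by ring)
  have hpiece : ∀ y'' : g.Site, Real.sqrt (∑ x, (hf x * T₀ (blockPiece (g := toB6 g R H) blk y'' (W μ)) x) ^ 2) ≤
      A₀ * Hh * Real.exp (-(r * g.dist y y'')) *
        (cv * Λ * AW * 1 * 1 * Real.exp (-(ρ' * g.dist y'' y')) * Real.sqrt (∑ x, μ x ^ 2)) := by
    intro y''
    have hν0 : ∀ x, blk x ≠ y'' → blockPiece (g := toB6 g R H) blk y'' (W μ) x = 0 := fun x hx => by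
      simp [blockPiece, hx]
    refine (hT₀ y y'' hf _ Hh hHh hh hh0 hν0).trans (mul_le_mul_of_nonneg_left ?_ (mul_nonneg (mul_nonneg hA₀ hHh) (Real.exp_nonneg _)))
    have hind : ∀ x, blockPiece (g := toB6 g R H) blk y'' (W μ) x = (if blk x = y'' then (1 : ℝ) else 0) * W μ x := fun x => by
      by_cases hx : blk x = y'' <;> simp [blockPiece, hx]
    have e : (∑ x, (blockPiece (g := toB6 g R H) blk y'' (W μ) x) ^ 2) = ∑ x, ((if blk x = y'' then (1 : ℝ) else 0) * W μ x) ^ 2 :=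
      Finset.sum_congr rfl fun x _ => by rw [hind x]
    rw [e]
    exact l2_block_of_kernelBound_transfer (R := R) (H := H) blk hv hc hvol hAW hρ'ρ hdnn hT (w := fun _ => (1 : ℝ))
      (fun _ => zero_le_one) hW' y'' y' (fun x => if blk x = y'' then (1 : ℝ) else 0) μ 1 zero_le_one
      (fun x => by by_cases hx : blk x = y'' <;> simp [hx]) (fun x hx => by simp [hx]) hμ0
  -- the `y″`-sum ([4] (2.61))
  have hsum : ∑ y'' : g.Site, Real.sqrt (∑ x, (hf x * T₀ (blockPiece (g := toB6 g R H) blk y'' (W μ)) x) ^ 2) ≤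
      A₀ * Hh * (cv * Λ * AW) * B6.c1 d δ₀ β * Real.exp (-(ρ' * g.dist y y')) * Real.sqrt (∑ x, μ x ^ 2) := by
    refine (Finset.sum_le_sum fun y'' _ => hpiece y'').trans ?_
    have hconv := conv_le (R := R) (H := H) d δ₀ α' β ρ' r 1 (fun _ => (1 : ℝ)) (fun _ => (1 : ℝ)) (fun _ => zero_le_one)
      (fun _ => zero_le_one) zero_le_one hρ' hr hdnn htri (scaleTransfer_one (mul_nonneg hα' hδ₀) hdnn) h261 y y'
    have e : ∑ y'' : g.Site, A₀ * Hh * Real.exp (-(r * g.dist y y'')) *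
          (cv * Λ * AW * 1 * 1 * Real.exp (-(ρ' * g.dist y'' y')) * Real.sqrt (∑ x, μ x ^ 2))
        = A₀ * Hh * (cv * Λ * AW) * Real.sqrt (∑ x, μ x ^ 2) *
          ∑ y'' : g.Site, ((1 : ℝ) * Real.exp (-(r * g.dist y y''))) * ((1 : ℝ) * Real.exp (-(ρ' * g.dist y'' y'))) := by
      rw [Finset.mul_sum]
      exact Finset.sum_congr rfl fun y'' _ => by ring
    rw [e]
    have hpre : 0 ≤ A₀ * Hh * (cv * Λ * AW) * Real.sqrt (∑ x, μ x ^ 2) :=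
      mul_nonneg (mul_nonneg (mul_nonneg hA₀ hHh) (mul_nonneg (mul_nonneg hcv hΛ) hAW)) hN
    refine (mul_le_mul_of_nonneg_left hconv hpre).trans (le_of_eq ?_)
    ring
  calc Real.sqrt (∑ x, (hf x * E μ x) ^ 2)
      ≤ A₀ * Hh * Real.exp (-(ρ' * g.dist y y')) * Real.sqrt (∑ x, μ x ^ 2) +
          A₀ * Hh * (cv * Λ * AW) * B6.c1 d δ₀ β * Real.exp (-(ρ' * g.dist y y')) * Real.sqrt (∑ x, μ x ^ 2) :=
        hmain.trans (add_le_add h1 hsum)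
    _ = (A₀ * (1 + cv * Λ * AW * B6.c1 d δ₀ β)) * Hh * Real.exp (-(ρ' * g.dist y y')) * Real.sqrt (∑ x, μ x ^ 2) := by ring

/-- The resolvent identity in the order of (3.65)₁: from `G(U)Δ(U) = 1` and `(Δ(U) − V)G(U′U) = 1`, `G(U′U) = G(U) + G(U)·(V·G(U′U))`.
[cite: Balaban1985BackgroundPropagators, (3.65) p.402 + (3.84)–(3.86) p.407 (bookkeeping ours)] -/
theorem resolvent_left {Rg : Type*} [Ring Rg] {Δa V G GExt : Rg} (hGΔ : G * Δa = 1) (hE : (Δa - V) * GExt = 1) :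
    GExt = G + G * (V * GExt) := by
  have e1 : G * ((Δa - V) * GExt) = G := by rw [hE, mul_one]
  have e2 : G * ((Δa - V) * GExt) = GExt - G * (V * GExt) := by
    rw [← mul_assoc, mul_sub, hGΔ, sub_mul, one_mul, mul_assoc]
  rw [e2] at e1
  exact sub_eq_iff_eq_add.mp e1

end Device

/-! ## §3  THEOREM 3.4 × THEOREM 3.1: THE `L²` MEMBER (3.46)₄ (TWO LEFT DIFFERENCES) FOR THE CONCRETE `G′(U′U)` OF (3.64), PRINTED QUANTIFIERS -/

section FinalGp

variable {𝔸 : Type*} [NormedRing 𝔸] [NormedAlgebra ℂ 𝔸] [CompleteSpace 𝔸] {ι : Type} [Fintype ι]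
variable (b : Module.Basis ι ℝ 𝔸) {S : Type} {κ : Type} [Fintype κ]
variable (T : κ → Equiv.Perm S) (U : κ → S → 𝔸ˣ)
variable {g : B9.Geometry} [Fintype g.Site] {Rr : ℝ} {H : Prop}

set_option maxHeartbeats 1600000 in
/-- **THEOREM 3.4 × THEOREM 3.1: THE `L²` MEMBER (3.46)₄ `‖h∇_U∇_UG′λ‖ ≦ B₀|h|e^{−δ₀d(y,y′)}‖λ‖` FOR THE CONCRETE `G′(U′U)` OF (3.64)** (for `U′U` by
Theorem 3.4 p. 400 and p. 403 l. 2–9).  HYPOTHESES = FILE 16 `thm34_Gp_kernel_final` VERBATIM + the block volumes `hvol` + [4] Lemma 2.1 for `v^{−1/2}`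
(`hSTv`) + NEW: (3.46)₄ FOR `G′(U)` as an `L²` block input for every pair of concrete first differences (`h346`, constant `B₄₆`).  CONCLUSION `∃ a₁ > 0 ∃ B
≧ 0 ∀ α₁ ≦ a₁ ∀ A kF sF …` (FILE 16's premises verbatim): `G′(U′U)` is the two-sided inverse of `Δ′_a(U) − V′(A)` ∧ `∀ k m ∀ y y′ ∀ h` (`|h| ≦ H`, `supp h
⊂ Δ(y)`) `∀ λ` (`supp λ ⊂ Δ(y′)`): `‖h∇_k∇_mG′(U′U)λ‖₂ ≦ BHe^{−(13δ₀/20)d(y,y′)}‖λ‖₂`.  PROOF: §2 with `T₀ = ∇_k∇_mG′(U)` (`h346`), `W = V′(A)G′(U′U)`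
(kernel bound `ineq363_kernel_vPrime` on FILE 16's `G′(U′U)`, `∇_kG′(U′U)` entries at `4δ₀/5`; `θ₃₆₃(α₁) ≦ K` below a threshold by continuity), `E =
∇_k∇_mG′(U′U) = T₀ + T₀W` by (3.65)₁ (`resolvent_left` on `G′Δ′ = 1`, `(Δ′ − V′)G′(U′U) = 1`); `B = B₄₆(1 + c_vΛ_vKc₁(δ₀, 1/20))`.  HONEST SCOPE: header.
[cite: Balaban1985BackgroundPropagators, Thm 3.4 p.400 + Thm 3.1 (3.46) p.398 + (3.60)–(3.65) p.402 + p.403 l.2–9 + p.393 + p.398 remark; Balaban1984PropagatorsII, (2.52) p.232 + (2.64)–(2.66) p.234 + Lemma 2.1 p.234] -/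
theorem thm34_Gp_l2_second_final [Fintype S] [DecidableEq S] [DecidableEq ι] [DecidableEq g.Site] [Nonempty g.Site] (blk : S → g.Site) (d : ℕ)
    (δ₀ BG Cq a₀ d₀ M₂ : ℝ)
    (kQ : g.Site → S → 𝔸 →L[ℝ] 𝔸) (sQ : S → 𝔸 →L[ℝ] 𝔸) (cfun w : g.Site → ℝ)
    (hBG : 0 < BG) (hCq : 0 ≤ Cq) (ha₀ : 0 ≤ a₀) (hM₂ : 0 ≤ M₂) (hδ₀ : 0 < δ₀)
    -- the multiscale geometry 𝔅 (p. 393, [4] (2.1)–(2.4)) and its axioms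
    (hdnn : ∀ a a' : g.Site, 0 ≤ g.dist a a') (htri : Triangle254 (toB6 g Rr H)) (hrefl : ∀ y : g.Site, g.dist y y = 0)
    (hsym : ∀ y y' : g.Site, g.dist y y' = g.dist y' y) (hlen : ∀ y : g.Site, 0 < g.len y) (hlenη : ∀ y : g.Site, g.eta ≤ g.len y)
    (hη : 0 < g.eta)
    -- [4] Lemma 2.1 (2.61) at the rate `δ₀`, «for every 0 < α < 1», and the p. 398 scale transfer for every exponent
    (h261 : ∀ α : ℝ, 0 < α → α < 1 → Ineq261 d (toB6 g Rr H) δ₀ α)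
    (hST : ∀ α : ℝ, 0 < α → ∃ Λ : ℝ, 1 ≤ Λ ∧ ScaleTransfer g δ₀ α Λ (fun a => g.len a) ∧ ScaleTransfer g δ₀ α Λ (fun a => g.len a ^ 2) ∧
      ScaleTransfer g δ₀ α Λ (fun a => (g.len a)⁻¹) ∧ ScaleTransfer g δ₀ α Λ (fun a => (g.len a ^ 2)⁻¹) ∧
      ScaleTransfer g δ₀ α Λ (fun a => (g.len a ^ 4)⁻¹) ∧ ScaleTransfer g δ₀ α Λ (fun y => g.len y ^ (-(4 : ℝ))))
    (hrepr : ∀ (v : 𝔸) (i : ι), |b.repr v i| ≤ M₂ * ‖v‖)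
    (hU1 : ∀ m z, ‖((U m z : 𝔸ˣ) : 𝔸)‖ ≤ 1 ∧ ‖(((U m z)⁻¹ : 𝔸ˣ) : 𝔸)‖ ≤ 1)
    (hd₀B : ∀ μ x, g.dist (blk x) (blk ((T μ).symm x)) ≤ d₀) (hd₀F : ∀ μ x, g.dist (blk x) (blk (T μ x)) ≤ d₀)
    (hd₀0 : ∀ y : g.Site, g.dist y y ≤ d₀)
    -- the `A`-independent data of the concrete `V′(A)` of (3.60)
    (hw : ∀ y, 0 ≤ w y) (hcard : ∀ y, ((B9Eq360Vprime.block blk y).card : ℝ) * w y ≤ 1)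
    (hkQ : ∀ y x, blk x = y → ‖kQ y x‖ ≤ w y) (hsQ : ∀ x, ‖sQ x‖ ≤ 1) (hcfun : ∀ y, |cfun y| ≤ a₀ * (g.len y ^ 2)⁻¹)
    -- THEOREM 3.1 for `G′(U)`: (3.24) `G′(U) = (Δ′_a(U))⁻¹` for the letter `Δ′_a(U)`, and (3.42)₁,₂,₃ at the rate `δ₀`
    {Δp Gp : Module.End ℝ (S × ι → ℝ)} (hΔpGp : Δp * Gp = 1) (hGpΔp : Gp * Δp = 1)
    (h342_1 : HasMajorant (g := toB6 g Rr H) (fun p : S × ι => blk p.1) Gp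
      (fun a a' => BG * g.len a ^ 2 * Real.exp (-(δ₀ * g.dist a a'))))
    (h342_2 : ∀ k : κ ⊕ κ, HasMajorant (g := toB6 g Rr H) (fun p : S × ι => blk p.1)
      (conj b (diffLetter T U ((g.eta : ℂ)⁻¹) k) * Gp) (fun a a' => BG * g.len a * Real.exp (-(δ₀ * g.dist a a'))))
    (h342_3 : ∀ k : κ ⊕ κ, HasMajorant (g := toB6 g Rr H) (fun p : S × ι => blk p.1)
      (Gp * conj b (diffLetter T U ((g.eta : ℂ)⁻¹) k)) (fun a a' => BG * g.len a * Real.exp (-(δ₀ * g.dist a a'))))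
    -- the kernel pairing of p. 393 (`c = η^d`, block volume weight `v(y′) = (L^{j′}η)^d`) and THEOREM 3.1's (3.42)₁₋₄ FOR `G′(U)` IN THE PRINTED KERNEL FORM
    {v : g.Site → ℝ} (hv : ∀ y, 0 < v y) {cK : ℝ} (hcK : 0 < cK)
    (hGpk : HasKernelBound (g := toB6 g Rr H) (fun p : S × ι => blk p.1) v cK Gp
      (fun a a' => BG * g.len a ^ 2 * Real.exp (-(δ₀ * g.dist a a'))))
    (hDGpk : ∀ k : κ ⊕ κ, HasKernelBound (g := toB6 g Rr H) (fun p : S × ι => blk p.1) v cK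
      (conj b (diffLetter T U ((g.eta : ℂ)⁻¹) k) * Gp) (fun a a' => BG * g.len a * Real.exp (-(δ₀ * g.dist a a'))))
    (hGpDk : ∀ l : κ ⊕ κ, HasKernelBound (g := toB6 g Rr H) (fun p : S × ι => blk p.1) v cK
      (Gp * conj b (diffLetter T U ((g.eta : ℂ)⁻¹) l)) (fun a a' => BG * g.len a * Real.exp (-(δ₀ * g.dist a a'))))
    (hDGpDk : ∀ k l : κ ⊕ κ, HasKernelBound (g := toB6 g Rr H) (fun p : S × ι => blk p.1) v cK
      (conj b (diffLetter T U ((g.eta : ℂ)⁻¹) k) * Gp * conj b (diffLetter T U ((g.eta : ℂ)⁻¹) l)) (fun a a' => BG * Real.exp (-(δ₀ * g.dist a a'))))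
    -- the block volumes in the kernel pairing (p. 393) and [4] Lemma 2.1 for the block-volume weight `v^{−1/2}` (p. 398 remark), as FILE 39
    (cv : ℝ) (hvol : ∀ y : g.Site, cK * ((Finset.univ.filter (fun p : S × ι => blk p.1 = y)).card : ℝ) ≤ cv * v y)
    (hSTv : ∀ α : ℝ, 0 < α → ∃ Λ : ℝ, 1 ≤ Λ ∧ ScaleTransfer g δ₀ α Λ (fun y => (Real.sqrt (v y))⁻¹))
    -- NEW: THEOREM 3.1's (3.46)₄ FOR `G′(U)` in `L²` block form («‖h∇_U∇_UG′(U)λ‖ ≦ B₀·1·|h|e^{−δ₀d(y,y′)}‖λ‖»), every pair of concrete first differences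
    (B46 : ℝ) (hB46 : 0 ≤ B46)
    (h346 : ∀ (k m : κ ⊕ κ) (y y'' : g.Site) (hf ν : S × ι → ℝ) (Hh : ℝ), 0 ≤ Hh → (∀ x, |hf x| ≤ Hh) → (∀ x, blk x.1 ≠ y → hf x = 0) →
      (∀ x, blk x.1 ≠ y'' → ν x = 0) →
      Real.sqrt (∑ x, (hf x * ((conj b (diffLetter T U ((g.eta : ℂ)⁻¹) k)) * (conj b (diffLetter T U ((g.eta : ℂ)⁻¹) m)) * Gp) ν x) ^ 2) ≤ B46 * Hh * Real.exp (-(δ₀ * g.dist y y'')) * Real.sqrt (∑ x, ν x ^ 2)) :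
    ∃ a₁ : ℝ, 0 < a₁ ∧ ∃ B : ℝ, 0 ≤ B ∧
    ∀ (α₁ : ℝ), 0 ≤ α₁ → α₁ ≤ a₁ →
    -- the exponent field `A` in the domain (3.37), read blockwise, and the `A`-dependent (3.59) data `kF`, `sF`
    ∀ (A : κ → S → 𝔸) (kF : g.Site → S → 𝔸 →L[ℝ] 𝔸) (sF : S → 𝔸 →L[ℝ] 𝔸),
      (∀ y x, blk x = y → ‖kF y x‖ ≤ Cq * α₁ * w y) → (∀ x, ‖sF x‖ ≤ Cq * α₁) →
      (∀ ν k x, ‖((g.eta : ℂ)⁻¹) • covDstar T U ν (A k) x‖ ≤ α₁ * (g.len (blk x) ^ 2)⁻¹) →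
      (∀ μ ν x, ‖((g.eta : ℂ)⁻¹) • covD T U μ (A ν) x‖ ≤ α₁ * (g.len (blk x) ^ 2)⁻¹) →
      (∀ μ x, ‖((g.eta : ℂ)⁻¹) • covDstar T U μ (tauB T U μ (A μ)) x‖ ≤ α₁ * (g.len (blk x) ^ 2)⁻¹) →
      (∀ k x, ‖A k x‖ ≤ α₁ * (g.len (blk x))⁻¹) → (∀ ν k x, ‖tauB T U ν (A k) x‖ ≤ α₁ * (g.len (blk x))⁻¹) →
      -- (i) `G′(U′U)` = the two-sided inverse of `Δ′_a(U) − V′(A)` (FILE 16/26, re-exported)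
      (Δp - (conj b (vPrimeConc T U g.eta A blk kQ kF sQ sF cfun))) * (gPrimeExtEnd Gp (conj b (vPrimeConc T U g.eta A blk kQ kF sQ sF cfun) * Gp)) = 1 ∧
      (gPrimeExtEnd Gp (conj b (vPrimeConc T U g.eta A blk kQ kF sQ sF cfun) * Gp)) * (Δp - (conj b (vPrimeConc T U g.eta A blk kQ kF sQ sF cfun))) = 1 ∧
      -- (viii′) NEW: the `L²` member (3.46)₄ of Theorem 3.1 for `G′(U′U)`, every pair of concrete first differences on the left
      (∀ (k m : κ ⊕ κ) (y y' : g.Site) (hf μ : S × ι → ℝ) (Hh : ℝ), 0 ≤ Hh → (∀ x, |hf x| ≤ Hh) → (∀ x, blk x.1 ≠ y → hf x = 0) →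
        (∀ x, blk x.1 ≠ y' → μ x = 0) →
        Real.sqrt (∑ x, (hf x * ((conj b (diffLetter T U ((g.eta : ℂ)⁻¹) k)) * (conj b (diffLetter T U ((g.eta : ℂ)⁻¹) m)) * (gPrimeExtEnd Gp (conj b (vPrimeConc T U g.eta A blk kQ kF sQ sF cfun) * Gp))) μ x) ^ 2) ≤
          B * Hh * Real.exp (-(13 / 20 * δ₀ * g.dist y y')) * Real.sqrt (∑ x, μ x ^ 2)) := by
  classical
  obtain ⟨y₀⟩ := ‹Nonempty g.Site›
  obtain ⟨a₁, ha₁, B', hB', H16⟩ := thm34_Gp_kernel_final (Rr := Rr) (H := H) b T U blk d δ₀ BG Cq a₀ d₀ M₂ kQ sQ cfun w hBG hCq ha₀ hM₂ hδ₀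
    hdnn htri hrefl hsym hlen hlenη hη h261 hST hrepr hU1 hd₀B hd₀F hd₀0 hw hcard hkQ hsQ hcfun hΔpGp hGpΔp h342_1 h342_2 h342_3 hv hcK hGpk hDGpk
    hGpDk hDGpDk
  -- the geometry: exponents `1/20` at the printed rate `δ₀`
  obtain ⟨Λ, hΛ1, hT1, hT2, -, -, -, -⟩ := hST (1 / 20) (by norm_num)
  have hΛ0 : 0 ≤ Λ := zero_le_one.trans hΛ1
  have h261β : Ineq261 d (toB6 g Rr H) δ₀ (1 / 20) := h261 _ (by norm_num) (by norm_num)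
  have hc₂ : 0 ≤ B6.c1 d δ₀ (1 / 20) := B6RandomWalk.c1_nonneg d δ₀ (1 / 20)
  obtain ⟨Λv, hΛv1, hTv⟩ := hSTv (1 / 20) (by norm_num)
  have hΛv0 : 0 ≤ Λv := zero_le_one.trans hΛv1
  have hcv : 0 ≤ cv := by
    have h4 : 0 ≤ cK * ((Finset.univ.filter (fun p : S × ι => blk p.1 = y₀)).card : ℝ) := by positivity
    have h0 : 0 * v y₀ ≤ cv * v y₀ := by rw [zero_mul]; exact h4.trans (hvol y₀)
    exact le_of_mul_le_mul_right h0 (hv y₀)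
  -- «of course with different constants» (p. 403): `θ₃₆₃(α₁)` is continuous at `α₁ = 0`, hence `≦ K` below a threshold
  obtain ⟨K, ε, hK, hε, hKb⟩ := exists_bound_of_continuousAt
    (f := fun α₁ : ℝ => theta363 (Fintype.card κ) 1 α₁ a₀ Cq M₂ (∑ i, ‖b i‖) (Real.exp (4 / 5 * δ₀ * d₀)) B' Λ (B6.c1 d δ₀ (1 / 20)))
    (by unfold theta363 kappa385 cVConc cBConc; fun_prop)
  have hBtot : 0 ≤ B46 * (1 + cv * Λv * K * B6.c1 d δ₀ (1 / 20)) :=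
    mul_nonneg hB46 (add_nonneg zero_le_one (mul_nonneg (mul_nonneg (mul_nonneg hcv hΛv0) hK) hc₂))
  refine ⟨min a₁ (min (ε / 2) (1 / 4)), lt_min ha₁ (lt_min (half_pos hε) (by norm_num)), B46 * (1 + cv * Λv * K * B6.c1 d δ₀ (1 / 20)), hBtot, ?_⟩
  intro α₁ hα₁0 hα₁1 A kF sF hkF hsF h337B h337F h337Bτ hA hAτB
  have hα₁a : α₁ ≤ a₁ := hα₁1.trans (min_le_left _ _)
  have hα₁ε : α₁ ≤ ε / 2 := hα₁1.trans ((min_le_right _ _).trans (min_le_left _ _))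
  have hα₁q : α₁ ≤ 1 / 4 := hα₁1.trans ((min_le_right _ _).trans (min_le_right _ _))
  obtain ⟨e1, e2, K1, K2, -, -⟩ := H16 α₁ hα₁0 hα₁a A kF sF hkF hsF h337B h337F h337Bτ hA hAτB
  have hθK : theta363 (Fintype.card κ) 1 α₁ a₀ Cq M₂ (∑ i, ‖b i‖) (Real.exp (4 / 5 * δ₀ * d₀)) B' Λ (B6.c1 d δ₀ (1 / 20)) ≤ K :=
    hKb α₁ (by rw [abs_of_nonneg hα₁0]; linarith)
  -- the shapes in which the letter lemmas read (3.37), the transports and the stencil geometry; «η·α₁(Lʲη)⁻¹ ≦ 1/4»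
  have hsmall : ∀ z : g.Site, g.eta * (α₁ * (g.len z)⁻¹) ≤ 1 / 4 := fun z => by
    have hq : g.eta * (g.len z)⁻¹ ≤ 1 := by
      rw [← div_eq_mul_inv]; exact (div_le_one (hlen z)).mpr (hlenη z)
    calc g.eta * (α₁ * (g.len z)⁻¹) = α₁ * (g.eta * (g.len z)⁻¹) := by ring
      _ ≤ α₁ * 1 := mul_le_mul_of_nonneg_left hq hα₁0
      _ ≤ 1 / 4 := by linarith only [hα₁q]
  have hA' : ∀ μ x, ‖A μ x‖ ≤ α₁ * (g.len (blk x))⁻¹ ∧ ‖tauB T U μ (A μ) x‖ ≤ α₁ * (g.len (blk x))⁻¹ :=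
    fun μ x => ⟨hA μ x, hAτB μ μ x⟩
  have h337s' : ∀ μ x, ‖((g.eta : ℂ)⁻¹) • covDstar T U μ (A μ) x‖ ≤ α₁ * (g.len (blk x) ^ 2)⁻¹ := fun μ x => h337B μ μ x
  have hd₀' : ∀ μ x, g.dist (blk x) (blk (T μ x)) ≤ d₀ ∧ g.dist (blk x) (blk ((T μ).symm x)) ≤ d₀ :=
    fun μ x => ⟨hd₀F μ x, hd₀B μ x⟩
  -- weights
  have hl21 : ∀ a : g.Site, g.len a ^ 2 * (g.len a)⁻¹ = g.len a := fun a => by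
    rw [pow_two, mul_assoc, mul_inv_cancel₀ (hlen a).ne', mul_one]
  have hl22 : ∀ a : g.Site, (g.len a ^ 2)⁻¹ * g.len a ^ 2 = 1 := fun a => inv_mul_cancel₀ (pow_ne_zero 2 (hlen a).ne')
  have hw21 : (fun a : g.Site => g.len a ^ 2 * (g.len a)⁻¹) = fun a => g.len a := funext hl21
  have hT21 : ScaleTransfer g δ₀ (1 / 20) Λ (fun a : g.Site => g.len a ^ 2 * (g.len a)⁻¹) := by rw [hw21]; exact hT1
  have hρ0 : (0 : ℝ) ≤ 7 / 10 * δ₀ := by linarith only [hδ₀]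
  have hrW : 7 / 10 * δ₀ + (1 / 20 + 1 / 20) * δ₀ ≤ 4 / 5 * δ₀ := by linarith only [hδ₀]
  have hδ45 : (0 : ℝ) ≤ 4 / 5 * δ₀ := by linarith only [hδ₀]
  -- (3.63) FOR THE EXTENDED OPERATOR: the kernel bound of `W = V′(A)G′(U′U)` from FILE 16's kernel entries of `G′(U′U)`, `∇_kG′(U′U)`
  have K2' : ∀ k : κ ⊕ κ, HasKernelBound (g := toB6 g Rr H) (fun p : S × ι => blk p.1) v cK ((conj b (diffLetter T U ((g.eta : ℂ)⁻¹) k)) * (gPrimeExtEnd Gp (conj b (vPrimeConc T U g.eta A blk kQ kF sQ sF cfun) * Gp)))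
      (fun a a' => B' * (g.len a ^ 2 * (g.len a)⁻¹) * Real.exp (-(4 / 5 * δ₀ * g.dist a a'))) := fun k =>
    hasKernelBound_mono (g := toB6 g Rr H) _ hv (K2 k) fun a a' => le_of_eq (by rw [hl21])
  have kW := ineq363_kernel_vPrime (Rr := Rr) (H := H) b T U blk d hη A kQ kF sQ sF cfun w 1 d₀ M₂ Cq a₀ δ₀ (4 / 5 * δ₀) (1 / 20) (1 / 20)
    (7 / 10 * δ₀) Λ B' α₁ (fun a => g.len a ^ 2) hB' hα₁0 hΛ0 hρ0 (by norm_num) (by norm_num) hδ₀.le hδ45 hrW hdnn htri hlen h261β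
    (fun a => sq_nonneg _) hT2 hT21 hM₂ hrepr hsmall hA' h337s' hU1 hd₀' hd₀0 hw hcard hCq ha₀ hkQ hkF hsQ hsF hcfun hv hcK
    (Tr := (gPrimeExtEnd Gp (conj b (vPrimeConc T U g.eta A blk kQ kF sQ sF cfun) * Gp))) K1 K2'
  have hW : HasKernelBound (g := toB6 g Rr H) (fun p : S × ι => blk p.1) v cK ((conj b (vPrimeConc T U g.eta A blk kQ kF sQ sF cfun)) * (gPrimeExtEnd Gp (conj b (vPrimeConc T U g.eta A blk kQ kF sQ sF cfun) * Gp)))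
      (fun a a' => K * Real.exp (-(7 / 10 * δ₀ * g.dist a a'))) := by
    refine hasKernelBound_mono (g := toB6 g Rr H) _ hv kW fun a a' => ?_
    rw [hl22, mul_one]
    exact mul_le_mul_of_nonneg_right hθK (Real.exp_nonneg _)
  have hρ' : (0 : ℝ) ≤ 13 / 20 * δ₀ := by linarith only [hδ₀]
  have hρ'ρ : 13 / 20 * δ₀ + 1 / 20 * δ₀ ≤ 7 / 10 * δ₀ := by linarith only [hδ₀]
  have hr : 13 / 20 * δ₀ + (1 / 20 + 1 / 20) * δ₀ ≤ δ₀ := by linarith only [hδ₀]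
  refine ⟨e1, e2, ?_⟩
  intro k m y y' hf μ Hh hHh hh hh0 hμ0
  -- (3.65)₁: `∇_k∇_mG′(U′U) = ∇_k∇_mG′(U) + ∇_k∇_mG′(U)·[V′(A)G′(U′U)]`
  have hEid : (conj b (diffLetter T U ((g.eta : ℂ)⁻¹) k)) * (conj b (diffLetter T U ((g.eta : ℂ)⁻¹) m)) * (gPrimeExtEnd Gp (conj b (vPrimeConc T U g.eta A blk kQ kF sQ sF cfun) * Gp)) = (conj b (diffLetter T U ((g.eta : ℂ)⁻¹) k)) * (conj b (diffLetter T U ((g.eta : ℂ)⁻¹) m)) * Gp + (conj b (diffLetter T U ((g.eta : ℂ)⁻¹) k)) * (conj b (diffLetter T U ((g.eta : ℂ)⁻¹) m)) * Gp * ((conj b (vPrimeConc T U g.eta A blk kQ kF sQ sF cfun)) * (gPrimeExtEnd Gp (conj b (vPrimeConc T U g.eta A blk kQ kF sQ sF cfun) * Gp))) := by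
    conv_lhs => rw [resolvent_left hGpΔp e1]
    noncomm_ring
  exact l2_left_transfer (R := Rr) (H := H) (fun p : S × ι => blk p.1) hv hcK hvol d hB46 hK hδ₀.le (by norm_num) (by norm_num) hρ' hρ'ρ hr hdnn htri h261β hTv
    hEid (h346 k m) hW y y' hf μ Hh hHh hh hh0 hμ0

end FinalGp

/-! ## §4  THEOREM 3.4 × THEOREM 3.3: THE `L²` MEMBER (3.46)₄ (TWO LEFT DIFFERENCES) FOR THE `G(U′U)` OF FILE 28, PRINTED QUANTIFIERS -/

section FinalG

variable {𝔸 : Type*} [NormedRing 𝔸] [NormedAlgebra ℂ 𝔸] [CompleteSpace 𝔸] {ι : Type} [Fintype ι]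
variable (b : Module.Basis ι ℝ 𝔸) {S : Type} {κ : Type} [Fintype κ] [LinearOrder κ]
variable (T : κ → Equiv.Perm S) (U : κ → S → 𝔸ˣ)
variable {g : B9.Geometry} [Fintype g.Site] {Rr : ℝ} {H : Prop}

set_option maxHeartbeats 3200000 in
/-- **THEOREM 3.4 × THEOREM 3.3: THE `L²` MEMBER (3.46)₄ `‖h∇_U∇_UGJ‖ ≦ B₀|h|e^{−δ₀d(y,y′)}‖J‖` FOR THE `G(U′U)` OF FILE 28** (Theorem 3.3 p. 399; for
`U′U` by Theorem 3.4 p. 400 and p. 407).  HYPOTHESES = FILE 28 `thm34_all_final` VERBATIM + `hvol` (bond carrier), `hSTv` + NEW: (3.46)₄ FOR `G(U)` as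
an `L²` block input for every pair of concrete first differences (`h346`).  CONCLUSION `∃ a₁ > 0 ∃ B ≧ 0 ∀ α₁ ≦ a₁ ∀ A …` (FILE 28's premises verbatim)
`∃ C⁻¹(U′U), G(U′U)` — FILE 28's pair ((ii)/(iii) identities re-exported) — with `∀ k m ∀ y y′ ∀ h` (`|h| ≦ H`, `supp h ⊂ Δ(y)`) `∀ J` (`supp J ⊂
Δ(y′)`): `‖h∇_k∇_mG(U′U)J‖₂ ≦ BHe^{−(7δ₀/100)d(y,y′)}‖J‖₂`.  PROOF: §2 with `T₀ = ∇_k∇_mG(U)` (`h346`), `W = V(A)G(U′U)`, `V(A) = V₃(A) + P₁(A)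
+ P₂(A)` ((3.84)) — kernel bound by `ineq385_kernel_sum` on FILE 28's kernel entries of `G(U′U)`, `∇_kG(U′U)` (rate `δ₀/10`) with the gradient form
and (3.73) sizes of the concrete `V₃(A)` (gen 11, at `δ₀/10`), (3.77) for `P₁(A)` (FILE 25 §3, `C⁻¹(U′U)` identified with FILE 28's by
`left_inv_eq_right_inv`, weakened to `δ₀/10`), (3.83) for `P₂(A)` (`ineq383_op`); the constant `κ₃₈₅(α₁)α₁ ≦ K_W` below a threshold by continuity;
`E = ∇_k∇_mG(U′U) = T₀ + T₀W` by `resolvent_left` on `GΔ_a(U) = 1` and `(Δ_a(U) − V(A))G(U′U) = 1` ((3.84) `eq384_sub` on FILE 28's identity).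
[cite: Balaban1985BackgroundPropagators, Thm 3.4 p.400 + Thm 3.3 p.399 + Thm 3.1 (3.46) p.398 + (3.73) p.405 + (3.76)–(3.77) pp.405–406 + (3.82)–(3.86) p.407 + p.393 + p.398 remark; Balaban1984PropagatorsII, (2.52) p.232 + (2.64)–(2.66) p.234 + Lemma 2.1 p.234] -/
theorem thm34_G_l2_second_final [Fintype S] [DecidableEq S] [DecidableEq ι] [DecidableEq g.Site] [Nonempty g.Site] (blk : S → g.Site) (d : ℕ)
    (δ₀ B₀ κQ BG B₁ cF Cq a₀ C₀ d₀ M₂ κQb cFb abar : ℝ)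
    (kQ : g.Site → S → 𝔸 →L[ℝ] 𝔸) (sQ : S → 𝔸 →L[ℝ] 𝔸) (cfun w : g.Site → ℝ)
    (hB₀ : 0 ≤ B₀) (hκQ : 0 < κQ) (hBG : 0 < BG) (hB₁ : 0 < B₁) (hcF : 0 < cF) (hCq : 0 ≤ Cq) (ha₀ : 0 ≤ a₀) (hC₀ : 0 ≤ C₀)
    (hM₂ : 0 ≤ M₂) (hδ₀ : 0 < δ₀) (hκQb : 0 ≤ κQb) (hcFb : 0 ≤ cFb) (habar : 0 ≤ abar)
    -- the multiscale geometry 𝔅 (p. 393, [4] (2.1)–(2.4)) and its axioms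
    (hdnn : ∀ a a' : g.Site, 0 ≤ g.dist a a') (htri : Triangle254 (toB6 g Rr H)) (hrefl : ∀ y : g.Site, g.dist y y = 0)
    (hsym : ∀ y y' : g.Site, g.dist y y' = g.dist y' y) (hlen : ∀ y : g.Site, 0 < g.len y) (hlenη : ∀ y : g.Site, g.eta ≤ g.len y)
    (hη : 0 < g.eta) (hL : 1 ≤ g.L)
    -- [4] Lemma 2.1 (2.61) at the rate `δ₀`, «for every 0 < α < 1»
    (h261 : ∀ α : ℝ, 0 < α → α < 1 → Ineq261 d (toB6 g Rr H) δ₀ α)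
    -- p. 398: «Using Lemma 2.1 in [4] we may replace the factor (Lʲη)^α by (Lʲη)^β(L^{j′}η)^γ with β + γ = α» — for every exponent, one
    -- constant `Λ(α) ≧ 1` for the six weights `(Lʲη)^{1,2,−1,−2,−4}` (natural and real powers)
    (hST : ∀ α : ℝ, 0 < α → ∃ Λ : ℝ, 1 ≤ Λ ∧ ScaleTransfer g δ₀ α Λ (fun a => g.len a) ∧ ScaleTransfer g δ₀ α Λ (fun a => g.len a ^ 2) ∧
      ScaleTransfer g δ₀ α Λ (fun a => (g.len a)⁻¹) ∧ ScaleTransfer g δ₀ α Λ (fun a => (g.len a ^ 2)⁻¹) ∧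
      ScaleTransfer g δ₀ α Λ (fun a => (g.len a ^ 4)⁻¹) ∧ ScaleTransfer g δ₀ α Λ (fun y => g.len y ^ (-(4 : ℝ))))
    -- real coordinates of `𝔸`, commuting translations, unitary-type background
    (hrepr : ∀ (v : 𝔸) (i : ι), |b.repr v i| ≤ M₂ * ‖v‖) (hT : ∀ (μ ν : κ) (x : S), T μ (T ν x) = T ν (T μ x))
    (hU1 : ∀ m z, ‖((U m z : 𝔸ˣ) : 𝔸)‖ ≤ 1 ∧ ‖(((U m z)⁻¹ : 𝔸ˣ) : 𝔸)‖ ≤ 1)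
    -- (3.35) on the plaquettes through each bond, at that bond's block scale; stencil geometry at range `d₀`
    (h35 : ∀ μ x m n y, Through T μ x m n y → ‖(plaqU T U m n y : 𝔸) - 1‖ ≤ C₀ * ((g.L ^ g.scale (blk x))⁻¹) ^ 2)
    (hd₀B : ∀ μ x, g.dist (blk x) (blk ((T μ).symm x)) ≤ d₀) (hd₀F : ∀ μ x, g.dist (blk x) (blk (T μ x)) ≤ d₀)
    (hd₀FB : ∀ μ ν x, g.dist (blk x) (blk ((T ν).symm (T μ x))) ≤ d₀)
    (hd₀st : ∀ μ x (q : κ × S), q ∈ stBonds T μ x → g.dist (blk x) (blk q.2) ≤ d₀)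
    (hd₀loc : ∀ μ x (q : κ × S), q ∈ B9Eq375Locality.locBondsA' T μ x → g.dist (blk x) (blk q.2) ≤ d₀)
    (hd₀0 : ∀ y : g.Site, g.dist y y ≤ d₀)
    -- the `A`-independent data of the concrete `V′(A)` of (3.60): (3.19) kernels/multipliers and the `a`-weights of (3.24)
    (hw : ∀ y, 0 ≤ w y) (hcard : ∀ y, ((B9Eq360Vprime.block blk y).card : ℝ) * w y ≤ 1)
    (hkQ : ∀ y x, blk x = y → ‖kQ y x‖ ≤ w y) (hsQ : ∀ x, ‖sQ x‖ ≤ 1) (hcfun : ∀ y, |cfun y| ≤ a₀ * (g.len y ^ 2)⁻¹)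
    -- THEOREM 3.1 for `G′(U)`: (3.42)₁,₂,₃ at the rate `δ₀`
    {Gp : Module.End ℝ (S × ι → ℝ)}
    (h342_1 : HasMajorant (g := toB6 g Rr H) (fun p : S × ι => blk p.1) Gp
      (fun a a' => BG * g.len a ^ 2 * Real.exp (-(δ₀ * g.dist a a'))))
    (h342_2 : ∀ k : κ ⊕ κ, HasMajorant (g := toB6 g Rr H) (fun p : S × ι => blk p.1)
      (conj b (diffLetter T U ((g.eta : ℂ)⁻¹) k) * Gp) (fun a a' => BG * g.len a * Real.exp (-(δ₀ * g.dist a a'))))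
    (h342_3 : ∀ k : κ ⊕ κ, HasMajorant (g := toB6 g Rr H) (fun p : S × ι => blk p.1)
      (Gp * conj b (diffLetter T U ((g.eta : ℂ)⁻¹) k)) (fun a a' => BG * g.len a * Real.exp (-(δ₀ * g.dist a a'))))
    -- (3.24): `G′(U) = (Δ′_a(U))⁻¹` for the letter `Δ′_a(U)`
    {Δp : Module.End ℝ (S × ι → ℝ)} (hΔpGp : Δp * Gp = 1) (hGpΔp : Gp * Δp = 1)
    -- the (3.19) letters `Q′(U)`, `Q′*(U)` in their own typing with block-local two-space majorants, a section of the block map (FILE 17)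
    (rep : g.Site → S × ι) (hrep : ∀ y : g.Site, blk (rep y).1 = y)
    {Qc : (S × ι → ℝ) →ₗ[ℝ] (g.Site → ℝ)} {Qcs : (g.Site → ℝ) →ₗ[ℝ] (S × ι → ℝ)} {Linv : Module.End ℝ (g.Site → ℝ)}
    (hQc : HasMajorantHom (g := toB6 g Rr H) (fun p : S × ι => blk p.1) (fun y : g.Site => y) Qc
      (fun a a' : g.Site => κQ * (if a = a' then (1 : ℝ) else 0)))
    (hQcs : HasMajorantHom (g := toB6 g Rr H) (fun y : g.Site => y) (fun p : S × ι => blk p.1) Qcs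
      (fun a a' : g.Site => κQ * (if a = a' then (1 : ℝ) else 0)))
    -- THEOREM 3.2 for `U`: (3.21) `C⁻¹ = (Q′G′²Q′*)⁻¹` exists (`hLinv`) with the KERNEL bound (3.48) at the rate `δ₀`
    (hLinv : (Qc ∘ₗ (Gp * Gp) ∘ₗ Qcs) * Linv = 1)
    (h348 : ∀ y y' : g.Site, |B9Thm34Inv.ker (B9Thm34Inv.vol g d) Linv y y'| ≤
      B₁ * g.len y ^ (-(4 : ℝ)) * g.len y' ^ (-(d : ℝ)) * Real.exp (-(δ₀ * g.dist y y')))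
    -- the (3.15) bond letters `Q(U)`, `Q*(U)` and the weight letter `a` of (3.24)/(3.26), with their majorants
    {G Qs Q a : Module.End ℝ ((κ × S) × ι → ℝ)}
    (hQb : HasMajorant (g := toB6 g Rr H) (fun q : (κ × S) × ι => blk q.1.2) Q (fun a a' => κQb * Real.exp (-(δ₀ * g.dist a a'))))
    (hQsb : HasMajorant (g := toB6 g Rr H) (fun q : (κ × S) × ι => blk q.1.2) Qs (fun a a' => κQb * Real.exp (-(δ₀ * g.dist a a'))))
    (ha324 : HasMajorant (g := toB6 g Rr H) (fun q : (κ × S) × ι => blk q.1.2) a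
      (fun a a' : g.Site => if a = a' then abar * (g.len a ^ 2)⁻¹ else 0))
    -- THEOREM 3.3 for `G(U)`: two-sided inverse of the concrete `Δ_a(U)` and its (3.42)-entries at the rate `δ₀`
    (hΔG : deltaA (conj b (lapDDLetter T ((g.eta : ℂ)⁻¹) U)) (conj b (dPrimeLetter T U g.eta))
      (conjHom b (gradLin T ((g.eta : ℂ)⁻¹) U) ∘ₗ (1 - (Gp ∘ₗ Qcs ∘ₗ Linv ∘ₗ Qc ∘ₗ Gp)) ∘ₗ conjHom b (divLin T ((g.eta : ℂ)⁻¹) U)) Qs a Q * G = 1)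
    (hGΔ : G * deltaA (conj b (lapDDLetter T ((g.eta : ℂ)⁻¹) U)) (conj b (dPrimeLetter T U g.eta))
      (conjHom b (gradLin T ((g.eta : ℂ)⁻¹) U) ∘ₗ (1 - (Gp ∘ₗ Qcs ∘ₗ Linv ∘ₗ Qc ∘ₗ Gp)) ∘ₗ conjHom b (divLin T ((g.eta : ℂ)⁻¹) U)) Qs a Q = 1)
    (hG : HasMajorant (g := toB6 g Rr H) (fun q : (κ × S) × ι => blk q.1.2) G
      (fun a a' => B₀ * g.len a ^ 2 * Real.exp (-(δ₀ * g.dist a a'))))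
    (hDG : ∀ k : κ ⊕ κ, HasMajorant (g := toB6 g Rr H) (fun q : (κ × S) × ι => blk q.1.2)
      (conj b (diffLetter (bT T) (bU U) ((g.eta : ℂ)⁻¹) k) * G) (fun a a' => B₀ * g.len a * Real.exp (-(δ₀ * g.dist a a'))))
    (hGD : ∀ k : κ ⊕ κ, HasMajorant (g := toB6 g Rr H) (fun q : (κ × S) × ι => blk q.1.2)
      (G * conj b (diffLetter (bT T) (bU U) ((g.eta : ℂ)⁻¹) k)) (fun a a' => B₀ * g.len a * Real.exp (-(δ₀ * g.dist a a'))))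
    -- (kernel form): Theorem 3.3's (3.42)₁,₂,₃,₄ for `G(U)` as PRINTED KERNEL BOUNDS (pairing weight `c = η^d`, volume weight `v(y′) = (L^j′ η)^d`)
    {v : g.Site → ℝ} (hv : ∀ y, 0 < v y) {c : ℝ} (hc : 0 < c)
    (hGk : HasKernelBound (g := toB6 g Rr H) (fun q : (κ × S) × ι => blk q.1.2) v c G
      (fun a a' => B₀ * g.len a ^ 2 * Real.exp (-(δ₀ * g.dist a a'))))
    (hDGk : ∀ k : κ ⊕ κ, HasKernelBound (g := toB6 g Rr H) (fun q : (κ × S) × ι => blk q.1.2) v c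
      (conj b (diffLetter (bT T) (bU U) ((g.eta : ℂ)⁻¹) k) * G) (fun a a' => B₀ * g.len a * Real.exp (-(δ₀ * g.dist a a'))))
    (hGDk : ∀ l : κ ⊕ κ, HasKernelBound (g := toB6 g Rr H) (fun q : (κ × S) × ι => blk q.1.2) v c
      (G * conj b (diffLetter (bT T) (bU U) ((g.eta : ℂ)⁻¹) l)) (fun a a' => B₀ * g.len a * Real.exp (-(δ₀ * g.dist a a'))))
    (hDGDk : ∀ k l : κ ⊕ κ, HasKernelBound (g := toB6 g Rr H) (fun q : (κ × S) × ι => blk q.1.2) v c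
      (conj b (diffLetter (bT T) (bU U) ((g.eta : ℂ)⁻¹) k) * G * conj b (diffLetter (bT T) (bU U) ((g.eta : ℂ)⁻¹) l)) (fun a a' => B₀ * Real.exp (-(δ₀ * g.dist a a'))))
    -- the block volumes of the bond carrier in the kernel pairing (p. 393) and [4] Lemma 2.1 for the block-volume weight `v^{−1/2}`, as FILE 39
    (cv : ℝ) (hvol : ∀ y : g.Site, c * ((Finset.univ.filter (fun q : (κ × S) × ι => blk q.1.2 = y)).card : ℝ) ≤ cv * v y)
    (hSTv : ∀ α : ℝ, 0 < α → ∃ Λ : ℝ, 1 ≤ Λ ∧ ScaleTransfer g δ₀ α Λ (fun y => (Real.sqrt (v y))⁻¹))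
    -- NEW: THEOREM 3.3's (3.46)₄ FOR `G(U)` in `L²` block form («‖h∇_U∇_UG(U)J‖ ≦ B₀·1·|h|e^{−δ₀d(y,y′)}‖J‖»), every pair of concrete first differences
    (B46 : ℝ) (hB46 : 0 ≤ B46)
    (h346 : ∀ (k m : κ ⊕ κ) (y y'' : g.Site) (hf ν : (κ × S) × ι → ℝ) (Hh : ℝ), 0 ≤ Hh → (∀ x, |hf x| ≤ Hh) → (∀ x, blk x.1.2 ≠ y → hf x = 0) →
      (∀ x, blk x.1.2 ≠ y'' → ν x = 0) →
      Real.sqrt (∑ x, (hf x * ((conj b (diffLetter (bT T) (bU U) ((g.eta : ℂ)⁻¹) k)) * (conj b (diffLetter (bT T) (bU U) ((g.eta : ℂ)⁻¹) m)) * G) ν x) ^ 2) ≤ B46 * Hh * Real.exp (-(δ₀ * g.dist y y'')) * Real.sqrt (∑ x, ν x ^ 2)) :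
    ∃ a₁ : ℝ, 0 < a₁ ∧ ∃ B : ℝ, 0 ≤ B ∧
    ∀ (α₁ : ℝ), 0 ≤ α₁ → α₁ ≤ a₁ →
    -- the exponent field `A` in the domain (3.37), read blockwise in the shapes of FILES 1–19, and the `A`-dependent (3.59) data `kF`, `sF`
    ∀ (A : κ → S → 𝔸) (kF : g.Site → S → 𝔸 →L[ℝ] 𝔸) (sF : S → 𝔸 →L[ℝ] 𝔸),
      (∀ y x, blk x = y → ‖kF y x‖ ≤ Cq * α₁ * w y) → (∀ x, ‖sF x‖ ≤ Cq * α₁) →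
      (∀ ν k x, ‖((g.eta : ℂ)⁻¹) • covDstar T U ν (A k) x‖ ≤ α₁ * (g.len (blk x) ^ 2)⁻¹) →
      (∀ μ ν x, ‖((g.eta : ℂ)⁻¹) • covD T U μ (A ν) x‖ ≤ α₁ * (g.len (blk x) ^ 2)⁻¹) →
      (∀ μ ν x, ‖((g.eta : ℂ)⁻¹) • covDstar T U ν (A ν) (T μ x)‖ ≤ α₁ * (g.len (blk x) ^ 2)⁻¹) →
      (∀ μ x, ‖((g.eta : ℂ)⁻¹) • covDstar T U μ (tauB T U μ (A μ)) x‖ ≤ α₁ * (g.len (blk x) ^ 2)⁻¹) →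
      (∀ μ ν k x, ‖((g.eta : ℂ)⁻¹) • covD T U μ (A k) ((T ν).symm x)‖ ≤ α₁ * (g.len (blk x) ^ 2)⁻¹) →
      (∀ k x, ‖A k x‖ ≤ α₁ * (g.len (blk x))⁻¹) → (∀ ν k x, ‖tauB T U ν (A k) x‖ ≤ α₁ * (g.len (blk x))⁻¹) →
      (∀ μ k x, ‖tauF T U μ (A k) x‖ ≤ α₁ * (g.len (blk x))⁻¹) →
      (∀ k μ ν x, ‖A k ((T ν).symm (T μ x))‖ ≤ α₁ * (g.len (blk x))⁻¹) →
      (∀ μ x m z, (m, z) ∈ stBonds T μ x → ‖A m z‖ ≤ α₁ * (g.len (blk x))⁻¹) →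
      (∀ μ x m z, (m, z) ∈ B9Eq375Locality.locBondsA T μ x → ‖A m z‖ ≤ α₁ * (g.len (blk x))⁻¹) →
      (∀ μ x m n y, Through T μ x m n y →
        ‖covD T U m (A n) y‖ ≤ g.eta * (α₁ * ((g.len (blk x))⁻¹) ^ 2) ∧ ‖covD T U n (A m) y‖ ≤ g.eta * (α₁ * ((g.len (blk x))⁻¹) ^ 2)) →
    -- the (3.57)/(3.59) letters `F′₂(A)`, `F′₂*(A)` (block-local, size `c_F α₁`)
    ∀ {Qc' Fc : (S × ι → ℝ) →ₗ[ℝ] (g.Site → ℝ)} {Qcs' Fcs : (g.Site → ℝ) →ₗ[ℝ] (S × ι → ℝ)},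
      Qc' = Qc + Fc → Qcs' = Qcs + Fcs →
      HasMajorantHom (g := toB6 g Rr H) (fun p : S × ι => blk p.1) (fun y : g.Site => y) Fc
        (fun a a' : g.Site => cF * α₁ * (if a = a' then (1 : ℝ) else 0)) →
      HasMajorantHom (g := toB6 g Rr H) (fun y : g.Site => y) (fun p : S × ι => blk p.1) Fcs
        (fun a a' : g.Site => cF * α₁ * (if a = a' then (1 : ℝ) else 0)) →
    -- the (3.80)–(3.81) letters `F₂(A)`, `F₂*(A)` («|F₂(A)|, |F₂*(A)| ≦ O(1)α₁»), `P₂(A)` of (3.82)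
    ∀ {P₂ Qs' Q' F₂ F₂s : Module.End ℝ ((κ × S) × ι → ℝ)},
      Q' = Q + F₂ → Qs' = Qs + F₂s → P₂ = pTwo Qs Q F₂ F₂s a →
      HasMajorant (g := toB6 g Rr H) (fun q : (κ × S) × ι => blk q.1.2) F₂ (fun a a' => cFb * α₁ * Real.exp (-(δ₀ * g.dist a a'))) →
      HasMajorant (g := toB6 g Rr H) (fun q : (κ × S) × ι => blk q.1.2) F₂s (fun a a' => cFb * α₁ * Real.exp (-(δ₀ * g.dist a a'))) →
    ∃ (Tinv : Module.End ℝ (g.Site → ℝ)) (GExt : Module.End ℝ ((κ × S) × ι → ℝ)),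
      -- (ii) `C⁻¹(U′U)` = THE two-sided inverse of `Q′(U′U)G′²(U′U)Q′*(U′U)` (FILE 28, re-exported)
      Tinv * (Qc' ∘ₗ ((gPrimeExtEnd Gp (conj b (vPrimeConc T U g.eta A blk kQ kF sQ sF cfun) * Gp)) * (gPrimeExtEnd Gp (conj b (vPrimeConc T U g.eta A blk kQ kF sQ sF cfun) * Gp))) ∘ₗ Qcs') = 1 ∧
      (Qc' ∘ₗ ((gPrimeExtEnd Gp (conj b (vPrimeConc T U g.eta A blk kQ kF sQ sF cfun) * Gp)) * (gPrimeExtEnd Gp (conj b (vPrimeConc T U g.eta A blk kQ kF sQ sF cfun) * Gp))) ∘ₗ Qcs') * Tinv = 1 ∧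
      -- (iii) `G(U′U)` = THE two-sided inverse of the concrete `Δ_a(U′U)` built with this `C⁻¹(U′U)` (FILE 28, re-exported)
      deltaA (conj b (lapDDLetter T ((g.eta : ℂ)⁻¹) (prodCfg U g.eta A)))
          (conj b (dPrimeLetter T (prodCfg U g.eta A) g.eta))
          (conjHom b (gradLin T ((g.eta : ℂ)⁻¹) (prodCfg U g.eta A)) ∘ₗ (1 - ((Gp ∘ₗ Qcs ∘ₗ Linv ∘ₗ Qc ∘ₗ Gp) + (B9Eq360Vprime.pPrime Gp (gPrimeExtEnd Gp (conj b (vPrimeConc T U g.eta A blk kQ kF sQ sF cfun) * Gp)) (Qcs ∘ₗ secRes rep) (Qcs' ∘ₗ secRes rep) (secConj rep Linv) (secConj rep Tinv) (secExt rep ∘ₗ Qc) (secExt rep ∘ₗ Qc'))))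
            ∘ₗ conjHom b (divLin T ((g.eta : ℂ)⁻¹) (prodCfg U g.eta A))) Qs' a Q' * GExt = 1 ∧
      GExt *
      deltaA (conj b (lapDDLetter T ((g.eta : ℂ)⁻¹) (prodCfg U g.eta A)))
          (conj b (dPrimeLetter T (prodCfg U g.eta A) g.eta))
          (conjHom b (gradLin T ((g.eta : ℂ)⁻¹) (prodCfg U g.eta A)) ∘ₗ (1 - ((Gp ∘ₗ Qcs ∘ₗ Linv ∘ₗ Qc ∘ₗ Gp) + (B9Eq360Vprime.pPrime Gp (gPrimeExtEnd Gp (conj b (vPrimeConc T U g.eta A blk kQ kF sQ sF cfun) * Gp)) (Qcs ∘ₗ secRes rep) (Qcs' ∘ₗ secRes rep) (secConj rep Linv) (secConj rep Tinv) (secExt rep ∘ₗ Qc) (secExt rep ∘ₗ Qc'))))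
            ∘ₗ conjHom b (divLin T ((g.eta : ℂ)⁻¹) (prodCfg U g.eta A))) Qs' a Q' = 1 ∧
      -- (viii) NEW: the `L²` member (3.46)₄ of Theorem 3.3 for THIS `G(U′U)`, every pair of concrete first differences on the left
      (∀ (k m : κ ⊕ κ) (y y' : g.Site) (hf μ : (κ × S) × ι → ℝ) (Hh : ℝ), 0 ≤ Hh → (∀ x, |hf x| ≤ Hh) → (∀ x, blk x.1.2 ≠ y → hf x = 0) →
        (∀ x, blk x.1.2 ≠ y' → μ x = 0) →
        Real.sqrt (∑ x, (hf x * ((conj b (diffLetter (bT T) (bU U) ((g.eta : ℂ)⁻¹) k)) * (conj b (diffLetter (bT T) (bU U) ((g.eta : ℂ)⁻¹) m)) * GExt) μ x) ^ 2) ≤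
          B * Hh * Real.exp (-(7 / 100 * δ₀ * g.dist y y')) * Real.sqrt (∑ x, μ x ^ 2)) := by
  classical
  obtain ⟨y₀⟩ := ‹Nonempty g.Site›
  -- FILE 28 (identities, kernel entries of `G(U′U)`), FILE 25 §3 ((3.77))
  obtain ⟨a₁, ha₁, B', hB', H28⟩ := thm34_all_final (Rr := Rr) (H := H) b T U blk d δ₀ B₀ κQ BG B₁ cF Cq a₀ C₀ d₀ M₂ κQb cFb abar kQ sQ
    cfun w hB₀ hκQ hBG hB₁ hcF hCq ha₀ hC₀ hM₂ hδ₀ hκQb hcFb habar hdnn htri hrefl hsym hlen hlenη hη hL h261 hST hrepr hT hU1 h35 hd₀B hd₀F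
    hd₀FB hd₀st hd₀loc hd₀0 hw hcard hkQ hsQ hcfun h342_1 h342_2 h342_3 hΔpGp hGpΔp rep hrep hQc hQcs hLinv h348 hQb hQsb ha324 hΔG hGΔ hG hDG
    hGD hv hc hGk hDGk hGDk hDGDk
  obtain ⟨a₂, ha₂, K, hK, H2⟩ := exists_threshold_pOne (Rr := Rr) (H := H) b T U blk d δ₀ κQ BG B₁ cF Cq a₀ d₀ M₂ kQ sQ cfun w hκQ hBG hB₁
    hcF hCq ha₀ hM₂ hδ₀ hdnn htri hrefl hsym hlen hlenη hη h261 hST hrepr hU1 hd₀B hd₀F hd₀0 hw hcard hkQ hsQ hcfun h342_1 h342_2 h342_3 rep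
    hrep hQc hQcs hLinv h348
  -- the geometry: exponents `1/100` at the printed rate `δ₀`
  obtain ⟨Λ, hΛ, hT1, hT2, hT1i, hT2i, -, -⟩ := hST (1 / 100) (by norm_num)
  have hΛ0 : 0 ≤ Λ := zero_le_one.trans hΛ
  have h261β : Ineq261 d (toB6 g Rr H) δ₀ (1 / 100) := h261 _ (by norm_num) (by norm_num)
  have hc₂ : 0 ≤ (B6.c1 d δ₀ (1 / 100)) := B6RandomWalk.c1_nonneg d δ₀ (1 / 100)
  obtain ⟨Λv, hΛv1, hTv⟩ := hSTv (1 / 100) (by norm_num)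
  have hΛv0 : 0 ≤ Λv := zero_le_one.trans hΛv1
  have hcv : 0 ≤ cv := by
    have h4 : 0 ≤ c * ((Finset.univ.filter (fun q : (κ × S) × ι => blk q.1.2 = y₀)).card : ℝ) := by positivity
    have h0 : 0 * v y₀ ≤ cv * v y₀ := by rw [zero_mul]; exact h4.trans (hvol y₀)
    exact le_of_mul_le_mul_right h0 (hv y₀)
  have hδ10 : (0 : ℝ) ≤ 1 / 10 * δ₀ := by linarith only [hδ₀]
  have hρW0 : (0 : ℝ) ≤ 2 / 25 * δ₀ := by linarith only [hδ₀]
  have hrW : 2 / 25 * δ₀ + (1 / 100 + 1 / 100) * δ₀ ≤ 1 / 10 * δ₀ := by linarith only [hδ₀]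
  have hrP : 1 / 10 * δ₀ + (1 / 100 + 1 / 100) * δ₀ ≤ δ₀ := by linarith only [hδ₀]
  have h105 : 1 / 10 * δ₀ ≤ 1 / 5 * δ₀ := by linarith only [hδ₀]
  have hρ' : (0 : ℝ) ≤ 7 / 100 * δ₀ := by linarith only [hδ₀]
  have hρ'ρ : 7 / 100 * δ₀ + 1 / 100 * δ₀ ≤ 2 / 25 * δ₀ := by linarith only [hδ₀]
  have hr : 7 / 100 * δ₀ + (1 / 100 + 1 / 100) * δ₀ ≤ δ₀ := by linarith only [hδ₀]
  -- «of course with different constants»: the (3.85)-constant `κ₃₈₅(α₁)α₁` of `W = V(A)G(U′U)` is continuous at `α₁ = 0`, hence bounded below a threshold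
  obtain ⟨KW, ε₁, hKW, hε₁, hFW⟩ := exists_bound_of_continuousAt
    (f := fun α₁ : ℝ => (kappa385 B' (cV385 (Fintype.card κ) α₁ C₀ (M₂ * (∑ i, ‖b i‖) * Real.exp (1 / 10 * δ₀ * d₀))) K (kappa383 κQb cFb abar Λ (B6.c1 d δ₀ (1 / 100)) α₁) Λ (B6.c1 d δ₀ (1 / 100)) * α₁))
    (by
      unfold kappa385 kappa383 cV385 B9Eq382V3Letters.cV0 B9Eq373V3.kΔ B9Eq373V3.kP
      fun_prop)
  have hBtot : 0 ≤ B46 * (1 + cv * Λv * KW * (B6.c1 d δ₀ (1 / 100))) :=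
    mul_nonneg hB46 (add_nonneg zero_le_one (mul_nonneg (mul_nonneg (mul_nonneg hcv hΛv0) hKW) hc₂))
  refine ⟨min (min (min a₁ a₂) (1 / 4)) (ε₁ / 2),
    lt_min (lt_min (lt_min ha₁ ha₂) (by norm_num)) (half_pos hε₁), B46 * (1 + cv * Λv * KW * (B6.c1 d δ₀ (1 / 100))), hBtot, ?_⟩
  intro α₁ hα₁0 hα₁1 A kF sF hkF hsF h337B h337F h337B' h337Bτ h337FB hA hAτB hAτF hAFB hAst hAloc hdAst Qc' Fc Qcs' Fcs h357
    h357s hFc hFcs P₂ Qs' Q' F₂ F₂s h380 h380s hP₂def hF₂ hF₂s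
  have hα₁a : α₁ ≤ a₁ := hα₁1.trans ((min_le_left _ _).trans ((min_le_left _ _).trans (min_le_left _ _)))
  have hα₁b : α₁ ≤ a₂ := hα₁1.trans ((min_le_left _ _).trans ((min_le_left _ _).trans (min_le_right _ _)))
  have hα₁q : α₁ ≤ 1 / 4 := hα₁1.trans ((min_le_left _ _).trans (min_le_right _ _))
  have habs : |α₁| = α₁ := abs_of_nonneg hα₁0
  have hα₁ε₁ : |α₁| < ε₁ := by rw [habs]; linarith only [hα₁1, min_le_right (min (min a₁ a₂) (1 / 4)) (ε₁ / 2), hε₁]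
  -- FILE 28 at this `α₁`, `A`: the pair, identities, kernel entries of `G(U′U)`
  obtain ⟨-, -, -, -, Tinv, GExt, e1, e2, -, -, -, -, -, -, -, -, -, e3, e4, -, -, K1, K2, -, -⟩ := H28 α₁ hα₁0 hα₁a A kF sF hkF
    hsF h337B h337F h337B' h337Bτ h337FB hA hAτB hAτF hAFB hAst hAloc hdAst h357 h357s hFc hFcs h380 h380s hP₂def hF₂ hF₂s
  -- FILE 25 §3 at this `α₁`, `A`: ITS `C⁻¹(U′U)` coincides with FILE 28's, so (3.77) holds for FILE 28's `P₁(A)`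
  obtain ⟨Tinv₂, f1, -, hP₁⟩ := H2 α₁ hα₁0 hα₁b A kF sF hkF hsF h337B h337F h337Bτ hA hAτB h357 h357s hFc hFcs
  have hTT : Tinv₂ = Tinv := left_inv_eq_right_inv f1 e2
  rw [hTT] at hP₁
  -- «η·α₁(Lʲη)⁻¹ ≦ 1/4», the concrete (3.73) letters at the rate `δ₀/10` (gen 11), (3.83) for `P₂(A)`, (3.77) weakened to `δ₀/10`
  have hsmall : ∀ z : g.Site, g.eta * (α₁ * (g.len z)⁻¹) ≤ 1 / 4 := fun z => by
    have hq : g.eta * (g.len z)⁻¹ ≤ 1 := by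
      rw [← div_eq_mul_inv]; exact (div_le_one (hlen z)).mpr (hlenη z)
    calc g.eta * (α₁ * (g.len z)⁻¹) = α₁ * (g.eta * (g.len z)⁻¹) := by ring
      _ ≤ α₁ * 1 := mul_le_mul_of_nonneg_left hq hα₁0
      _ ≤ 1 / 4 := by linarith only [hα₁q]
  have hMc0 : 0 ≤ (M₂ * (∑ i, ‖b i‖) * Real.exp (1 / 10 * δ₀ * d₀)) := by positivity
  have hcV0 := cV0_nonneg (Fintype.card κ) hα₁0 hC₀
  have hcV : 0 ≤ (cV385 (Fintype.card κ) α₁ C₀ (M₂ * (∑ i, ‖b i‖) * Real.exp (1 / 10 * δ₀ * d₀))) := cV385_nonneg (Fintype.card κ) hα₁0 hC₀ hMc0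
  have hκ₂ : 0 ≤ (kappa383 κQb cFb abar Λ (B6.c1 d δ₀ (1 / 100)) α₁) := kappa383_nonneg hκQb hcFb habar hΛ0 hc₂ hα₁0
  have hV₃ := conj_V₃Op_eq_gradForm T U b g.eta A
  have hV₃' := conj_V₃Op_eq_vThree T U b g.eta A
  have h371 := conj_lapDDLetter_prodCfg (b := b) (T := T) (U := U) hη.ne' A
  have hV0 := hasMajorant_V₃_zero (Rr := Rr) (H := H) b T U blk hη hL A C₀ d₀ (1 / 10 * δ₀) M₂ α₁ hα₁0 hC₀ hδ10 hM₂ hrepr hlen hsmall hU1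
    h337B h337F h337B' hAst hAloc hdAst h35 hd₀B hd₀F hd₀FB hd₀st hd₀loc hd₀0
  have hV1 := hasMajorant_V₃_one (Rr := Rr) (H := H) b T U blk A d₀ (1 / 10 * δ₀) M₂ α₁ hα₁0 hδ10 hM₂ hrepr hlen hA hAτB hAτF hU1 hd₀B hd₀F hd₀0
  have hV0' : HasMajorant (g := toB6 g Rr H) (fun q : (κ × S) × ι => blk q.1.2)
      (conj b (zeroLetter T U ((g.eta : ℂ)⁻¹) A + F₁Letter T U g.eta A)
        - conj b (dPrimeLetter T (prodCfg U g.eta A) g.eta - dPrimeLetter T U g.eta)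
        + conj b (zeroLetter₂ T U ((g.eta : ℂ)⁻¹) A + F₂Letter T U g.eta A))
      (fun a a' => (cV385 (Fintype.card κ) α₁ C₀ (M₂ * (∑ i, ‖b i‖) * Real.exp (1 / 10 * δ₀ * d₀))) * α₁ * (g.len a ^ 2)⁻¹ * Real.exp (-(1 / 10 * δ₀ * g.dist a a'))) := by
    refine hasMajorant_mono (g := toB6 g Rr H) _ hV0 fun z z' => ?_
    have h0' : 0 ≤ 28 * (Fintype.card κ : ℝ) * (Fintype.card κ + 1) * (M₂ * (∑ i, ‖b i‖) * Real.exp (1 / 10 * δ₀ * d₀)) * α₁ * (g.len z ^ 2)⁻¹ *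
        Real.exp (-(1 / 10 * δ₀ * g.dist z z')) := by
      positivity
    have e : (cV385 (Fintype.card κ) α₁ C₀ (M₂ * (∑ i, ‖b i‖) * Real.exp (1 / 10 * δ₀ * d₀))) * α₁ * (g.len z ^ 2)⁻¹ * Real.exp (-(1 / 10 * δ₀ * g.dist z z'))
        = cV0 (Fintype.card κ) α₁ C₀ * M₂ * (∑ i, ‖b i‖) * Real.exp (1 / 10 * δ₀ * d₀) * α₁ * (g.len z ^ 2)⁻¹ *
            Real.exp (-(1 / 10 * δ₀ * g.dist z z'))
          + 28 * (Fintype.card κ : ℝ) * (Fintype.card κ + 1) * (M₂ * (∑ i, ‖b i‖) * Real.exp (1 / 10 * δ₀ * d₀)) * α₁ * (g.len z ^ 2)⁻¹ *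
            Real.exp (-(1 / 10 * δ₀ * g.dist z z')) := by
      unfold cV385; ring
    rw [e]
    linarith
  have hcK0 : ∀ k ∈ (Finset.univ : Finset (κ ⊕ κ)), (0 : ℝ) ≤ (14 * ((Fintype.card κ : ℝ) + 1) * M₂ * (∑ i, ‖b i‖) * Real.exp (1 / 10 * δ₀ * d₀)) := fun k _ => by positivity
  have hsum : ∑ _k ∈ (Finset.univ : Finset (κ ⊕ κ)), (14 * ((Fintype.card κ : ℝ) + 1) * M₂ * (∑ i, ‖b i‖) * Real.exp (1 / 10 * δ₀ * d₀)) ≤ (cV385 (Fintype.card κ) α₁ C₀ (M₂ * (∑ i, ‖b i‖) * Real.exp (1 / 10 * δ₀ * d₀))) := by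
    rw [Finset.sum_const, Finset.card_univ, Fintype.card_sum, nsmul_eq_mul, Nat.cast_add]
    have h0' : 0 ≤ cV0 (Fintype.card κ) α₁ C₀ * (M₂ * (∑ i, ‖b i‖) * Real.exp (1 / 10 * δ₀ * d₀)) := mul_nonneg hcV0 hMc0
    have e : (cV385 (Fintype.card κ) α₁ C₀ (M₂ * (∑ i, ‖b i‖) * Real.exp (1 / 10 * δ₀ * d₀))) = cV0 (Fintype.card κ) α₁ C₀ * (M₂ * (∑ i, ‖b i‖) * Real.exp (1 / 10 * δ₀ * d₀))
          + ((Fintype.card κ : ℝ) + Fintype.card κ) * (14 * ((Fintype.card κ : ℝ) + 1) * M₂ * (∑ i, ‖b i‖) * Real.exp (1 / 10 * δ₀ * d₀)) := by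
      unfold cV385; ring
    rw [e]
    linarith
  have hP₂ : HasMajorant (g := toB6 g Rr H) (fun q : (κ × S) × ι => blk q.1.2) P₂
      (fun a a' => (kappa383 κQb cFb abar Λ (B6.c1 d δ₀ (1 / 100)) α₁) * α₁ * (g.len a ^ 2)⁻¹ * Real.exp (-(1 / 10 * δ₀ * g.dist a a'))) := by
    rw [hP₂def]
    exact ineq383_op (R := Rr) (H := H) (fun q : (κ × S) × ι => blk q.1.2) d δ₀ δ₀ (1 / 100) (1 / 100) (1 / 10 * δ₀) Λ κQb cFb abar α₁ hκQb hcFb habar hα₁0 hΛ0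
      hδ10 (by norm_num) (by norm_num) hδ₀.le hrP hdnn htri h261β hT2i hQb hQsb hF₂ hF₂s ha324
  have hP₁' := hasMajorant_rate_mono (R := Rr) (H := H) (fun q : (κ × S) × ι => blk q.1.2) (K * α₁) (fun a => (g.len a ^ 2)⁻¹) (mul_nonneg hK hα₁0)
    (fun a => inv_nonneg.mpr (sq_nonneg _)) h105 hdnn hP₁
  -- (3.84) for the concrete letters, hence `(Δ_a(U) − V(A))G(U′U) = 1` from FILE 28's identity
  have h384 : deltaA (conj b (lapDDLetter T ((g.eta : ℂ)⁻¹) (prodCfg U g.eta A)))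
        (conj b (dPrimeLetter T (prodCfg U g.eta A) g.eta))
        (conjHom b (gradLin T ((g.eta : ℂ)⁻¹) (prodCfg U g.eta A)) ∘ₗ (1 - ((Gp ∘ₗ Qcs ∘ₗ Linv ∘ₗ Qc ∘ₗ Gp) + (B9Eq360Vprime.pPrime Gp (gPrimeExtEnd Gp (conj b (vPrimeConc T U g.eta A blk kQ kF sQ sF cfun) * Gp)) (Qcs ∘ₗ secRes rep) (Qcs' ∘ₗ secRes rep) (secConj rep Linv) (secConj rep Tinv) (secExt rep ∘ₗ Qc) (secExt rep ∘ₗ Qc'))))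
          ∘ₗ conjHom b (divLin T ((g.eta : ℂ)⁻¹) (prodCfg U g.eta A))) Qs' a Q' =
      deltaA (conj b (lapDDLetter T ((g.eta : ℂ)⁻¹) U)) (conj b (dPrimeLetter T U g.eta))
        (conjHom b (gradLin T ((g.eta : ℂ)⁻¹) U) ∘ₗ (1 - (Gp ∘ₗ Qcs ∘ₗ Linv ∘ₗ Qc ∘ₗ Gp)) ∘ₗ conjHom b (divLin T ((g.eta : ℂ)⁻¹) U)) Qs a Q -
        vTotal (conj b (V₃Op T U g.eta A))
          (((conjHom b (gradLin T ((g.eta : ℂ)⁻¹) (prodCfg U g.eta A)) - conjHom b (gradLin T ((g.eta : ℂ)⁻¹) U))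
              ∘ₗ (Gp ∘ₗ Qcs ∘ₗ Linv ∘ₗ Qc ∘ₗ Gp) ∘ₗ conjHom b (divLin T ((g.eta : ℂ)⁻¹) U)
            + conjHom b (gradLin T ((g.eta : ℂ)⁻¹) U) ∘ₗ (Gp ∘ₗ Qcs ∘ₗ Linv ∘ₗ Qc ∘ₗ Gp)
              ∘ₗ (conjHom b (divLin T ((g.eta : ℂ)⁻¹) (prodCfg U g.eta A)) - conjHom b (divLin T ((g.eta : ℂ)⁻¹) U))
            + (conjHom b (gradLin T ((g.eta : ℂ)⁻¹) (prodCfg U g.eta A)) - conjHom b (gradLin T ((g.eta : ℂ)⁻¹) U))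
              ∘ₗ (Gp ∘ₗ Qcs ∘ₗ Linv ∘ₗ Qc ∘ₗ Gp)
              ∘ₗ (conjHom b (divLin T ((g.eta : ℂ)⁻¹) (prodCfg U g.eta A)) - conjHom b (divLin T ((g.eta : ℂ)⁻¹) U))
            + conjHom b (gradLin T ((g.eta : ℂ)⁻¹) (prodCfg U g.eta A)) ∘ₗ (B9Eq360Vprime.pPrime Gp (gPrimeExtEnd Gp (conj b (vPrimeConc T U g.eta A blk kQ kF sQ sF cfun) * Gp)) (Qcs ∘ₗ secRes rep) (Qcs' ∘ₗ secRes rep) (secConj rep Linv) (secConj rep Tinv) (secExt rep ∘ₗ Qc) (secExt rep ∘ₗ Qc'))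
              ∘ₗ conjHom b (divLin T ((g.eta : ℂ)⁻¹) (prodCfg U g.eta A))))
          P₂ := by
    rw [eq384_sub (conj b (lapDDLetter T ((g.eta : ℂ)⁻¹) U)) (conj b (lapDDLetter T ((g.eta : ℂ)⁻¹) (prodCfg U g.eta A)))
      (conj b (dPrimeLetter T U g.eta)) (conj b (dPrimeLetter T (prodCfg U g.eta A) g.eta)) _ _ Qs Qs' Q Q' a
      (conj b (V₁Op T U g.eta A)) (conj b (V₂Op T U g.eta A)) _ F₂ F₂s h371
      (eq376_concrete T U b hη.ne' A (Gp ∘ₗ Qcs ∘ₗ Linv ∘ₗ Qc ∘ₗ Gp) (B9Eq360Vprime.pPrime Gp (gPrimeExtEnd Gp (conj b (vPrimeConc T U g.eta A blk kQ kF sQ sF cfun) * Gp)) (Qcs ∘ₗ secRes rep) (Qcs' ∘ₗ secRes rep) (secConj rep Linv) (secConj rep Tinv) (secExt rep ∘ₗ Qc) (secExt rep ∘ₗ Qc'))) h380 h380s, hV₃', hP₂def]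
  have hE := e3
  rw [h384] at hE
  -- kernel entries of `G(U′U)` in the weight shapes, and (3.85) FOR THE EXTENDED OPERATOR: the kernel bound of `W = V(A)G(U′U)`
  have hl21 : ∀ a : g.Site, g.len a ^ 2 * (g.len a)⁻¹ = g.len a := fun a => by
    rw [pow_two, mul_assoc, mul_inv_cancel₀ (hlen a).ne', mul_one]
  have hl22 : ∀ a : g.Site, (g.len a ^ 2)⁻¹ * g.len a ^ 2 = 1 := fun a => inv_mul_cancel₀ (pow_ne_zero 2 (hlen a).ne')
  have hw21 : (fun a : g.Site => g.len a ^ 2 * (g.len a)⁻¹) = fun a => g.len a := funext hl21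
  have hT21 : ScaleTransfer g δ₀ (1 / 100) Λ (fun a : g.Site => g.len a ^ 2 * (g.len a)⁻¹) := by rw [hw21]; exact hT1
  have K2' : ∀ k ∈ (Finset.univ : Finset (κ ⊕ κ)), HasKernelBound (g := toB6 g Rr H) (fun q : (κ × S) × ι => blk q.1.2) v c ((conj b (diffLetter (bT T) (bU U) ((g.eta : ℂ)⁻¹) k)) * GExt)
      (fun a a' => B' * (g.len a ^ 2 * (g.len a)⁻¹) * Real.exp (-(1 / 10 * δ₀ * g.dist a a'))) := fun k _ =>
    hasKernelBound_mono (g := toB6 g Rr H) _ hv (K2 k) fun a a' => le_of_eq (by rw [hl21])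
  have hP₂' : HasMajorant (g := toB6 g Rr H) (fun q : (κ × S) × ι => blk q.1.2) P₂
      (fun a a' => (kappa383 κQb cFb abar Λ (B6.c1 d δ₀ (1 / 100)) α₁) * α₁ * (g.len a ^ 2)⁻¹ * Real.exp (-(1 / 10 * δ₀ * g.dist a a'))) := hP₂
  have kW := ineq385_kernel_sum (R := Rr) (H := H) (fun q : (κ × S) × ι => blk q.1.2) d (Finset.univ : Finset (κ ⊕ κ)) δ₀ (1 / 10 * δ₀) (1 / 100) (1 / 100)
    (2 / 25 * δ₀) Λ B' (cV385 (Fintype.card κ) α₁ C₀ (M₂ * (∑ i, ‖b i‖) * Real.exp (1 / 10 * δ₀ * d₀))) K (kappa383 κQb cFb abar Λ (B6.c1 d δ₀ (1 / 100)) α₁) α₁ (fun _ => (14 * ((Fintype.card κ : ℝ) + 1) * M₂ * (∑ i, ‖b i‖) * Real.exp (1 / 10 * δ₀ * d₀))) (fun a => g.len a ^ 2) hB' hcV hK hκ₂ hα₁0 hΛ0 hρW0 (by norm_num) (by norm_num) hδ₀.le hrW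
    (fun a => sq_nonneg _) hcK0 hsum hdnn htri hlen h261β hT2 hT21 hv hc
    (P₁ := (((conjHom b (gradLin T ((g.eta : ℂ)⁻¹) (prodCfg U g.eta A)) - conjHom b (gradLin T ((g.eta : ℂ)⁻¹) U))
              ∘ₗ (Gp ∘ₗ Qcs ∘ₗ Linv ∘ₗ Qc ∘ₗ Gp) ∘ₗ conjHom b (divLin T ((g.eta : ℂ)⁻¹) U)
            + conjHom b (gradLin T ((g.eta : ℂ)⁻¹) U) ∘ₗ (Gp ∘ₗ Qcs ∘ₗ Linv ∘ₗ Qc ∘ₗ Gp)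
              ∘ₗ (conjHom b (divLin T ((g.eta : ℂ)⁻¹) (prodCfg U g.eta A)) - conjHom b (divLin T ((g.eta : ℂ)⁻¹) U))
            + (conjHom b (gradLin T ((g.eta : ℂ)⁻¹) (prodCfg U g.eta A)) - conjHom b (gradLin T ((g.eta : ℂ)⁻¹) U))
              ∘ₗ (Gp ∘ₗ Qcs ∘ₗ Linv ∘ₗ Qc ∘ₗ Gp)
              ∘ₗ (conjHom b (divLin T ((g.eta : ℂ)⁻¹) (prodCfg U g.eta A)) - conjHom b (divLin T ((g.eta : ℂ)⁻¹) U))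
            + conjHom b (gradLin T ((g.eta : ℂ)⁻¹) (prodCfg U g.eta A)) ∘ₗ (B9Eq360Vprime.pPrime Gp (gPrimeExtEnd Gp (conj b (vPrimeConc T U g.eta A blk kQ kF sQ sF cfun) * Gp)) (Qcs ∘ₗ secRes rep) (Qcs' ∘ₗ secRes rep) (secConj rep Linv) (secConj rep Tinv) (secExt rep ∘ₗ Qc) (secExt rep ∘ₗ Qc'))
              ∘ₗ conjHom b (divLin T ((g.eta : ℂ)⁻¹) (prodCfg U g.eta A)))))
    (P₂ := P₂)
    (V1 := fun k => conj b (V1Letter T U A k) + conj b (V1Letter₂ T U A k))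
    (D := fun k => (conj b (diffLetter (bT T) (bU U) ((g.eta : ℂ)⁻¹) k)))
    hV₃ hV0' (fun k _ => hV1 k) hP₁' hP₂' (T := GExt) K1 K2'
  have hKWb : (kappa385 B' (cV385 (Fintype.card κ) α₁ C₀ (M₂ * (∑ i, ‖b i‖) * Real.exp (1 / 10 * δ₀ * d₀))) K (kappa383 κQb cFb abar Λ (B6.c1 d δ₀ (1 / 100)) α₁) Λ (B6.c1 d δ₀ (1 / 100)) * α₁) ≤ KW := hFW α₁ hα₁ε₁
  have hW : HasKernelBound (g := toB6 g Rr H) (fun q : (κ × S) × ι => blk q.1.2) v c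
      (vTotal (conj b (V₃Op T U g.eta A))
          (((conjHom b (gradLin T ((g.eta : ℂ)⁻¹) (prodCfg U g.eta A)) - conjHom b (gradLin T ((g.eta : ℂ)⁻¹) U))
              ∘ₗ (Gp ∘ₗ Qcs ∘ₗ Linv ∘ₗ Qc ∘ₗ Gp) ∘ₗ conjHom b (divLin T ((g.eta : ℂ)⁻¹) U)
            + conjHom b (gradLin T ((g.eta : ℂ)⁻¹) U) ∘ₗ (Gp ∘ₗ Qcs ∘ₗ Linv ∘ₗ Qc ∘ₗ Gp)
              ∘ₗ (conjHom b (divLin T ((g.eta : ℂ)⁻¹) (prodCfg U g.eta A)) - conjHom b (divLin T ((g.eta : ℂ)⁻¹) U))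
            + (conjHom b (gradLin T ((g.eta : ℂ)⁻¹) (prodCfg U g.eta A)) - conjHom b (gradLin T ((g.eta : ℂ)⁻¹) U))
              ∘ₗ (Gp ∘ₗ Qcs ∘ₗ Linv ∘ₗ Qc ∘ₗ Gp)
              ∘ₗ (conjHom b (divLin T ((g.eta : ℂ)⁻¹) (prodCfg U g.eta A)) - conjHom b (divLin T ((g.eta : ℂ)⁻¹) U))
            + conjHom b (gradLin T ((g.eta : ℂ)⁻¹) (prodCfg U g.eta A)) ∘ₗ (B9Eq360Vprime.pPrime Gp (gPrimeExtEnd Gp (conj b (vPrimeConc T U g.eta A blk kQ kF sQ sF cfun) * Gp)) (Qcs ∘ₗ secRes rep) (Qcs' ∘ₗ secRes rep) (secConj rep Linv) (secConj rep Tinv) (secExt rep ∘ₗ Qc) (secExt rep ∘ₗ Qc'))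
              ∘ₗ conjHom b (divLin T ((g.eta : ℂ)⁻¹) (prodCfg U g.eta A))))
          P₂ * GExt)
      (fun a a' => KW * Real.exp (-(2 / 25 * δ₀ * g.dist a a'))) := by
    refine hasKernelBound_mono (g := toB6 g Rr H) _ hv kW fun a a' => ?_
    rw [hl22, mul_one]
    exact mul_le_mul_of_nonneg_right hKWb (Real.exp_nonneg _)
  refine ⟨Tinv, GExt, e1, e2, e3, e4, ?_⟩
  intro k m y y' hf μ Hh hHh hh hh0 hμ0
  -- (3.65)₁-type identity for `G`: `∇_k∇_mG(U′U) = ∇_k∇_mG(U) + ∇_k∇_mG(U)·[V(A)G(U′U)]`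
  have hEid : (conj b (diffLetter (bT T) (bU U) ((g.eta : ℂ)⁻¹) k)) * (conj b (diffLetter (bT T) (bU U) ((g.eta : ℂ)⁻¹) m)) * GExt = (conj b (diffLetter (bT T) (bU U) ((g.eta : ℂ)⁻¹) k)) * (conj b (diffLetter (bT T) (bU U) ((g.eta : ℂ)⁻¹) m)) * G + (conj b (diffLetter (bT T) (bU U) ((g.eta : ℂ)⁻¹) k)) * (conj b (diffLetter (bT T) (bU U) ((g.eta : ℂ)⁻¹) m)) * G *
      (vTotal (conj b (V₃Op T U g.eta A))
          (((conjHom b (gradLin T ((g.eta : ℂ)⁻¹) (prodCfg U g.eta A)) - conjHom b (gradLin T ((g.eta : ℂ)⁻¹) U))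
              ∘ₗ (Gp ∘ₗ Qcs ∘ₗ Linv ∘ₗ Qc ∘ₗ Gp) ∘ₗ conjHom b (divLin T ((g.eta : ℂ)⁻¹) U)
            + conjHom b (gradLin T ((g.eta : ℂ)⁻¹) U) ∘ₗ (Gp ∘ₗ Qcs ∘ₗ Linv ∘ₗ Qc ∘ₗ Gp)
              ∘ₗ (conjHom b (divLin T ((g.eta : ℂ)⁻¹) (prodCfg U g.eta A)) - conjHom b (divLin T ((g.eta : ℂ)⁻¹) U))
            + (conjHom b (gradLin T ((g.eta : ℂ)⁻¹) (prodCfg U g.eta A)) - conjHom b (gradLin T ((g.eta : ℂ)⁻¹) U))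
              ∘ₗ (Gp ∘ₗ Qcs ∘ₗ Linv ∘ₗ Qc ∘ₗ Gp)
              ∘ₗ (conjHom b (divLin T ((g.eta : ℂ)⁻¹) (prodCfg U g.eta A)) - conjHom b (divLin T ((g.eta : ℂ)⁻¹) U))
            + conjHom b (gradLin T ((g.eta : ℂ)⁻¹) (prodCfg U g.eta A)) ∘ₗ (B9Eq360Vprime.pPrime Gp (gPrimeExtEnd Gp (conj b (vPrimeConc T U g.eta A blk kQ kF sQ sF cfun) * Gp)) (Qcs ∘ₗ secRes rep) (Qcs' ∘ₗ secRes rep) (secConj rep Linv) (secConj rep Tinv) (secExt rep ∘ₗ Qc) (secExt rep ∘ₗ Qc'))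
              ∘ₗ conjHom b (divLin T ((g.eta : ℂ)⁻¹) (prodCfg U g.eta A))))
          P₂ * GExt) := by
    conv_lhs => rw [resolvent_left hGΔ hE]
    noncomm_ring
  exact l2_left_transfer (R := Rr) (H := H) (fun q : (κ × S) × ι => blk q.1.2) hv hc hvol d hB46 hKW hδ₀.le (by norm_num) (by norm_num) hρ' hρ'ρ hr hdnn htri h261β hTv
    hEid (h346 k m) hW y y' hf μ Hh hHh hh hh0 hμ0

end FinalG

end Literature.MathematicalPhysics.QuantumFieldTheory.Balaban1983to89.B9Ineq346L2SecondDiff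

end
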